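import Mathlib.Analysis.SpecialFunctions.Pow.Real
import Literature.Computability.QuantumComplexity.MatchgateCliffordAlgebra
import Literature.Computability.Complexity.CodeFPLists
import Literature.Computability.Complexity.CodeFPListKit
import Literature.Computability.Complexity.CodeFPStrings
import Literature.Computability.Complexity.CodeFPOfUnary
import Literature.Computability.Cryptography.QuantumCircuitDescFP
import Literature.Computability.Cryptography.PolyTimeComputableGramSchmidt
import HarnessLib

/-!
# The Jozsa–Miyake estimator: fixed-point row recursion, its error bound, and its polynomial-time string program

Topic `Literature/Computability/QuantumComplexity`, model namespace `Matchgate`. Proof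
infrastructure for the discharge of the named fact `JozsaMiyake2008_thm1`
(`MatchgateSimulation.lean`), on top of part I `MatchgateCliffordAlgebra.lean` (vocabulary `LIdx`,
`MIdx`, `InBlock`, `locOf`, `blockIdx`, `embE`, `vecMul_embE_apply`, `zExp`, `rotOf`, `pauli`,
`coef`, `wireSwap`). Part II (`MatchgateHeisenberg.lean`) delivers the acceptance probability of a
nearest-neighbour matchgate circuit on a basis input as `p₁ = (1 − ⟨Z₀⟩)/2`,
`⟨Z₀⟩ = zExp x v₀ v₁`, with `v_b` the row `(0, b)` of the product `E_T ⋯ E_1` of the block-embedded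
rotations of the gates (JM08 §4, eqs. (8), (10)). The printed proof stops there ("hence poly-time
computable"), treating real arithmetic as exact; the tree's statement asks for a Turing-machine
estimator to `k` bits for gates whose entries are merely polynomial-time computable complex
numbers. This file supplies that algorithmic half, in three layers (a sibling file
`MatchgateNumerics.lean` develops an alternative, orthogonality-based error analysis with a
different list layout; the present file is self-contained on top of part I):

1. **Numerics** (fixed point, crude entrywise bounds). `stepList D j rl w` — one scaled row update
   `w ↦ w · Ẽ` on a list of `2N` integers (on the flat positions `2j … 2j+3` the `4 × 4` integer
   block `blockOfList rl ≈ D·R`, elsewhere multiplication by `D = 2^L`); `rowList` (head gate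
   LAST: it acts first, its factor is rightmost); `zExpInt` (integer read-out
   `Σ_i (−1)^{y_i}(w₀[2i]w₁[2i+1] − w₀[2i+1]w₁[2i])`); `estOf` (`round(2^k(D^{2T} − S̃)/(2D^{2T}))`,
   `0` on the empty register); `rowExact` (the exact rows, `ᵥ* embE`); the invariant
   `|w_t − D^t v_t| ≤ e_t` (`abs_rowList_sub_le`, `mul_errB_le : D e_t ≤ t 8^t D^t`) and
   **`abs_estOf_div_sub_le`**: `D ≥ 6 N T² 64^T 2^k` gives `|est/2^k − p₁| ≤ 2^{-k}`.
2. **The string program** (`Complexity/CodeFP*.lean`, no machine is written): `stepList_codeFP`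
   (a `mapIdx`), `rowList_codeFP` (a `foldl` over the reversed gate data, with the polynomial bound
   `length_rawE_foldl_stepList_le` on the accumulator: entries grow by a factor `|D| + 4Σ|rl|` per
   step), `zExpInt_codeFP`, `estOfZ_codeFP`; gate codes `QGate.encode` parsed by `symOfCode`,
   `wire0OfCode`, `wire1OfCode`; `estParsed` on `((n, m, codes), x, k)` — whose code is LITERALLY
   `Instance.encode` (`Instance.encode_eq_parsed`) — with precision `L = k + 8T + N + 3`;
   **`estInstance_polyTime`**: `PolyTimeComputable Instance.encode encodingIntBool.encode` for
   every rotation table computed on codes, and `estInstance_eq` (what it computes).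
3. **The rotation table of a finite alphabet** with entries in `C̃`: `isPolyTimeComputableReal_rotOf`
   (the `SO(4)` block of a gate with poly-time entries has poly-time real entries: `coef`, `rot2`
   are ring expressions), `approxFn` (the dyadic names, chosen), `blockApprox`, `rotTable`
   (finite case analysis over the alphabet), `rotTable_codeFP`, **`abs_rotTable_sub_le`**
   (`|r̃ − 2^L R| ≤ 1`), and the estimator **`jmEst`** with **`jmEst_polyTime`**.

The assembly with part II is `MatchgateSimulationProofs.lean`.

## References

* R. Jozsa, A. Miyake, *Matchgates and classical simulation of quantum circuits*, Proc. R. Soc. A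
  464 (2008) 3089–3106 = arXiv:0804.4050, Thm. 1, §4 eqs. (8), (10) ("Hence the full matrix
  `R̃` is poly time computable"). [JozsaMiyake2008]
* S. Arora, B. Barak, *Computational Complexity: A Modern Approach*, CUP 2009, §1.3 (closure of
  polynomial time under composition and polynomially bounded loops; numbers in binary).
  [AroraBarak2009]
* K.-I. Ko, *Complexity Theory of Real Functions*, Birkhäuser 1991, Def. 2.1, §2.2 (dyadic names;
  ring closure of the polynomial-time computable reals). [Ko1991]
-/

namespace Literature.Computability.QuantumComplexity.Matchgate

section Numerics

open Matrix Finset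



variable {N : ℕ}

/-! ### Flat positions of Majorana indices -/

/-- The flat position `2o + b` of a local index `(o, b)` of a block (`0 … 3`). [folklore] -/
def lflat (ν : LIdx) : ℕ := 2 * (ν.1 : ℕ) + (if ν.2 then 1 else 0)

/-- The flat position `2i + b` of the Majorana index `(i, b)` in a row vector written as a list of
length `2N` (`c_{2i+1}, c_{2i+2}` of JM08 are the entries `2i, 2i+1`). [folklore] -/
def flat (q : MIdx N) : ℕ := 2 * (q.1 : ℕ) + (if q.2 then 1 else 0)

/-- `lflat ν < 4`. [folklore] -/
theorem lflat_lt (ν : LIdx) : lflat ν < 4 := by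
  obtain ⟨o, b⟩ := ν
  have := o.isLt
  simp only [lflat]
  split_ifs <;> omega

/-- `flat q < 2N`. [folklore] -/
theorem flat_lt (q : MIdx N) : flat q < 2 * N := by
  obtain ⟨i, b⟩ := q
  have := i.isLt
  simp only [flat]
  split_ifs <;> omega

/-- `flat` is injective. [folklore] -/
theorem flat_injective : Function.Injective (flat : MIdx N → ℕ) := by
  rintro ⟨i, b⟩ ⟨i', b'⟩ h
  have hi : (i : ℕ) = i' := by cases b <;> cases b' <;> simp [flat] at h <;> omega
  have hb : b = b' := by cases b <;> cases b' <;> simp [flat] at h ⊢ <;> omega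
  exact Prod.ext (Fin.ext hi) hb

/-- The flat position of a block index. [folklore] -/
theorem flat_blockIdx (j : ℕ) (h : j + 2 ≤ N) (ν : LIdx) : flat (blockIdx j h ν) = 2 * j + lflat ν := by
  simp only [flat, lflat, blockIdx_apply, blockEmb_apply_val]
  ring

/-- The local index of the flat position `p` relative to the block at `j` (meaningful for
`2j ≤ p < 2j + 4`). [folklore] -/
def locFlat (j p : ℕ) : LIdx := (if p < 2 * j + 2 then 0 else 1, decide (p % 2 = 1))

/-- `locFlat` on flat positions of the block is `locOf`. [folklore] -/
theorem locFlat_flat {j : ℕ} {q : MIdx N} (hq : InBlock j q.1) : locFlat j (flat q) = locOf j q := by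
  obtain ⟨i, b⟩ := q
  simp only [InBlock] at hq
  simp only [locFlat, flat, locOf]
  refine Prod.ext ?_ ?_
  · by_cases hi : (i : ℕ) = j
    · rw [if_pos hi, if_pos]; cases b <;> simp <;> omega
    · rw [if_neg hi, if_neg]; cases b <;> simp <;> omega
  · cases b <;> simp

/-- Block membership read off the flat position. [folklore] -/
theorem inBlock_iff_flat (j : ℕ) (q : MIdx N) : InBlock j q.1 ↔ 2 * j ≤ flat q ∧ flat q < 2 * j + 4 := by
  obtain ⟨i, b⟩ := q
  simp only [InBlock, flat]
  cases b <;> simp <;> omega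

/-- `locFlat` of a block position. [folklore] -/
theorem locFlat_lflat (j : ℕ) (ν : LIdx) : locFlat j (2 * j + lflat ν) = ν := by
  obtain ⟨o, b⟩ := ν
  simp only [locFlat, lflat]
  refine Prod.ext ?_ ?_
  · fin_cases o <;> cases b <;> simp
  · cases b <;> simp

/-! ### The integer row recursion -/

/-- A four-term sum over the local indices, written out (the form the string program computes).
[folklore] -/
def sum4 (f : LIdx → ℤ) : ℤ := f (0, false) + f (0, true) + f (1, false) + f (1, true)

/-- `sum4` is the sum over `LIdx`. [folklore] -/
theorem sum4_eq (f : LIdx → ℤ) : sum4 f = ∑ ν, f ν := by rw [sum_lIdx]; rfl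

/-- The integer block of a list of `16` integers in row-major order of the flat local indices:
`r_{μν} = rl[4·lflat μ + lflat ν]`. [folklore] -/
def blockOfList (rl : List ℤ) : Matrix LIdx LIdx ℤ := fun μ ν => rl.getD (4 * lflat μ + lflat ν) 0

/-- **One step of the integer row recursion** `w ↦ w · Ẽ` for the gate datum `(j, rl)`: `rl` lists
an integer `4 × 4` matrix `r = blockOfList rl` (an approximant of `D · R`, `R` the rotation of the
gate on the block `{j, j+1}`), and `Ẽ` is `r` on the block's four flat positions `2j … 2j+3` and
`D` times the identity elsewhere — the scaled, rounded form of JM08's row update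
`w ↦ w (1 ⊕ R ⊕ 1)`; in the block, position `p` is the local column `p − 2j`.
[cite: JozsaMiyake2008, §4 (the product of the SO(2n) matrices of the gates)] -/
def stepList (D : ℤ) (j : ℕ) (rl : List ℤ) (w : List ℤ) : List ℤ :=
  w.mapIdx fun p x => if 2 * j ≤ p ∧ p < 2 * j + 4 then
    sum4 (fun μ => w.getD (2 * j + lflat μ) 0 * rl.getD (4 * lflat μ + (p - 2 * j)) 0) else D * x

/-- In the block, the local column of the flat position `p` is `p − 2j`. [folklore] -/
theorem lflat_locFlat {j p : ℕ} (h1 : 2 * j ≤ p) (h2 : p < 2 * j + 4) : lflat (locFlat j p) = p - 2 * j := by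
  simp only [lflat, locFlat]
  by_cases h : p < 2 * j + 2
  · rw [if_pos h]; by_cases hp : p % 2 = 1 <;> simp [hp] <;> omega
  · rw [if_neg h]; by_cases hp : p % 2 = 1 <;> simp [hp] <;> omega

/-- The initial row: the unit vector at the Majorana `(0, b)` (flat position `b`), length `2N`.
[folklore] -/
def initList (N : ℕ) (b : Bool) : List ℤ :=
  (List.range (2 * N)).map fun p => if p = (if b then 1 else 0) then 1 else 0

/-- **The integer rows**: the recursion over the gate data, the HEAD of the list applied LAST
(the head gate acts first on the state, so its rotation is the rightmost factor of the total
rotation and the last factor met by a row vector). [cite: JozsaMiyake2008, §4 eq. (8)] -/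
def rowList (D : ℤ) (N : ℕ) (b : Bool) : List (ℕ × List ℤ) → List ℤ
  | [] => initList N b
  | g :: gs => stepList D g.1 g.2 (rowList D N b gs)

/-- The sign `(-1)^{y_i}` of the input bit `i` (bits beyond the list are `0`). [folklore] -/
def sgnOf (y : List Bool) (i : ℕ) : ℤ := if y.getD i false then -1 else 1

/-- **The integer form of `⟨Z₀⟩`** (JM08 eq. (10) on a basis input), from the two integer rows:
`Σ_{i<N} (-1)^{y_i} (w₀[2i] w₁[2i+1] − w₀[2i+1] w₁[2i])`. [cite: JozsaMiyake2008, §4 eq. (10)] -/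
def zExpInt (y : List Bool) (N : ℕ) (w₀ w₁ : List ℤ) : ℤ :=
  ((List.range N).map fun i => sgnOf y i *
    (w₀.getD (2 * i) 0 * w₁.getD (2 * i + 1) 0 - w₀.getD (2 * i + 1) 0 * w₁.getD (2 * i) 0)).sum

/-- **The estimate**: `round(2^k (D^{2T} − S̃) / (2 D^{2T}))`, an integer `a` with
`a / 2^k ≈ p₁ = (1 − ⟨Z₀⟩)/2`; `0` on the empty register (where the tree's `acceptProb` is `0`).
[cite: JozsaMiyake2008, Thm 1 (p₁ = (1 − ⟨Z_k⟩)/2)] -/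
def estOf (k D N T : ℕ) (S : ℤ) : ℤ :=
  if N = 0 then 0 else (2 ^ k * ((D : ℤ) ^ (2 * T) - S) + (D : ℤ) ^ (2 * T)) / (2 * (D : ℤ) ^ (2 * T))

/-! ### Entries of the integer rows -/

/-- Length of a step. [folklore] -/
@[simp] theorem length_stepList (D : ℤ) (j : ℕ) (rl : List ℤ) (w : List ℤ) :
    (stepList D j rl w).length = w.length := by
  simp [stepList]

/-- Length of the initial row. [folklore] -/
@[simp] theorem length_initList (N : ℕ) (b : Bool) : (initList N b).length = 2 * N := by
  simp [initList]

/-- Length of the integer rows. [folklore] -/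
@[simp] theorem length_rowList (D : ℤ) (N : ℕ) (b : Bool) : ∀ gs, (rowList D N b gs).length = 2 * N
  | [] => length_initList N b
  | g :: gs => by rw [rowList, length_stepList, length_rowList D N b gs]

/-- Entries of a step. [folklore] -/
theorem getD_stepList (D : ℤ) (j : ℕ) (rl : List ℤ) (w : List ℤ) {p : ℕ} (hp : p < w.length) :
    (stepList D j rl w).getD p 0 = if 2 * j ≤ p ∧ p < 2 * j + 4 then
      sum4 (fun μ => w.getD (2 * j + lflat μ) 0 * rl.getD (4 * lflat μ + (p - 2 * j)) 0) else D * w.getD p 0 := by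
  rw [List.getD_eq_getElem?_getD, stepList, List.getElem?_mapIdx, List.getElem?_eq_getElem hp]
  simp [List.getD_eq_getElem?_getD, List.getElem?_eq_getElem hp]

/-- Entries of the initial row. [folklore] -/
theorem getD_initList (N : ℕ) (b : Bool) {p : ℕ} (hp : p < 2 * N) :
    (initList N b).getD p 0 = if p = (if b then 1 else 0) then 1 else 0 := by
  rw [List.getD_eq_getElem?_getD, initList, List.getElem?_map, List.getElem?_range hp]
  simp

/-- The integer row read as a function of Majorana indices. [folklore] -/
def rowFun (w : List ℤ) (q : MIdx N) : ℤ := w.getD (flat q) 0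

/-- **The step on Majorana indices**: in the block, the four-term sum against the column
`locOf q` of `r`; off the block, multiplication by `D`. [cite: JozsaMiyake2008, §4] -/
theorem rowFun_stepList (D : ℤ) {j : ℕ} (h : j + 2 ≤ N) (rl : List ℤ) {w : List ℤ}
    (hw : w.length = 2 * N) (q : MIdx N) :
    rowFun (stepList D j rl w) q = if InBlock j q.1 then
      ∑ μ : LIdx, rowFun w (blockIdx j h μ) * blockOfList rl μ (locOf j q) else D * rowFun w q := by
  unfold rowFun
  rw [getD_stepList D j rl w (by rw [hw]; exact flat_lt q)]
  by_cases hq : InBlock j q.1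
  · have hf := (inBlock_iff_flat j q).1 hq
    rw [if_pos hf, if_pos hq, sum4_eq]
    refine sum_congr rfl fun μ _ => ?_
    rw [flat_blockIdx, blockOfList, ← lflat_locFlat hf.1 hf.2, locFlat_flat hq]
  · rw [if_neg (fun h' => hq ((inBlock_iff_flat j q).2 h')), if_neg hq]

/-- The initial row on Majorana indices is the unit vector at `(0, b)`. [folklore] -/
theorem rowFun_initList (N : ℕ) (b : Bool) (q : MIdx N) :
    rowFun (initList N b) q = if (q.1 : ℕ) = 0 ∧ q.2 = b then 1 else 0 := by
  unfold rowFun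
  rw [getD_initList N b (flat_lt q)]
  obtain ⟨i, b'⟩ := q
  cases b <;> cases b' <;> simp [flat]


/-! ### The exact rows and their size -/

/-- **The exact rows** of the total rotation: the same recursion with the real block matrices,
`v_b([]) = e_{(0,b)}`, `v_b(g :: gs) = v_b(gs) · E(g)` with `E(g) = embE j R` (JM08 eq. (8): the
rows `(0,X), (0,Y)` of the product of the `SO(2n)` matrices of the gates, the head gate's factor
rightmost). [cite: JozsaMiyake2008, §4 eq. (8)] -/
noncomputable def rowExact (N : ℕ) (b : Bool) : List (ℕ × Matrix LIdx LIdx ℝ) → (MIdx N → ℝ)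
  | [] => fun q => if (q.1 : ℕ) = 0 ∧ q.2 = b then 1 else 0
  | g :: gs => rowExact N b gs ᵥ* embE g.1 g.2

/-- `|LIdx| = 4`. [folklore] -/
theorem card_lIdx : Fintype.card LIdx = 4 := by simp [LIdx]

/-- A sum of four terms each bounded by `c` is bounded by `4c`. [folklore] -/
theorem abs_sum_lIdx_le {f : LIdx → ℝ} {c : ℝ} (h : ∀ ν, |f ν| ≤ c) : |∑ ν, f ν| ≤ 4 * c :=
  calc |∑ ν, f ν| ≤ ∑ ν, |f ν| := abs_sum_le_sum_abs _ _
    _ ≤ ∑ _ν : LIdx, c := sum_le_sum fun ν _ => h ν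
    _ = 4 * c := by rw [sum_const, card_univ, card_lIdx]; simp

/-- **Growth of the exact rows**: with block entries at most `1` in absolute value, after `T`
gates every entry is at most `4^T`. [folklore] -/
theorem abs_rowExact_le (N : ℕ) (b : Bool) : ∀ (gs : List (ℕ × Matrix LIdx LIdx ℝ)),
    (∀ g ∈ gs, g.1 + 2 ≤ N) → (∀ g ∈ gs, ∀ μ ν, |g.2 μ ν| ≤ 1) →
    ∀ q, |rowExact N b gs q| ≤ 4 ^ gs.length
  | [], _, _, q => by
    simp only [rowExact, List.length_nil, pow_zero]
    split_ifs <;> simp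
  | g :: gs, hj, hR, q => by
    have ih := abs_rowExact_le N b gs (fun g' hg' => hj g' (List.mem_cons_of_mem _ hg'))
      (fun g' hg' => hR g' (List.mem_cons_of_mem _ hg'))
    have hg := hj g List.mem_cons_self
    rw [rowExact, vecMul_embE_apply g.1 hg, List.length_cons, pow_succ]
    split_ifs with hq
    · rw [mul_comm]
      refine abs_sum_lIdx_le fun μ => ?_
      rw [abs_mul]
      calc |rowExact N b gs (blockIdx g.1 hg μ)| * |g.2 μ (locOf g.1 q)| ≤ 4 ^ gs.length * 1 :=
            mul_le_mul (ih _) (hR g List.mem_cons_self _ _) (abs_nonneg _) (by positivity)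
        _ = 4 ^ gs.length := mul_one _
    · calc |rowExact N b gs q| ≤ 4 ^ gs.length := ih q
        _ ≤ 4 ^ gs.length * 4 := le_mul_of_one_le_right (by positivity) (by norm_num)

/-! ### The error recursion -/

/-- The error bound after `t` gates: `e₀ = 0`, `e_{t+1} = 4(D+1) e_t + 4 (4D)^t`. [folklore] -/
def errB (D : ℝ) : ℕ → ℝ
  | 0 => 0
  | t + 1 => 4 * (D + 1) * errB D t + 4 * (4 * D) ^ t

/-- `errB` is nonnegative for `D ≥ 0`. [folklore] -/
theorem errB_nonneg {D : ℝ} (hD : 0 ≤ D) : ∀ t, 0 ≤ errB D t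
  | 0 => le_rfl
  | t + 1 => by
    have := errB_nonneg hD t
    simp only [errB]; positivity

/-- **Closed bound for the error recursion**: `D · e_t ≤ t · 8^t · D^t` for `D ≥ 1`. [folklore] -/
theorem mul_errB_le {D : ℝ} (hD : 1 ≤ D) : ∀ t : ℕ, D * errB D t ≤ t * 8 ^ t * D ^ t
  | 0 => by simp [errB]
  | t + 1 => by
    have ih := mul_errB_le hD t
    have hD0 : 0 ≤ D := zero_le_one.trans hD
    have h8 : (0 : ℝ) ≤ 8 ^ t := by positivity
    have hDt : (0 : ℝ) ≤ D ^ t := by positivity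
    have h4 : (4 : ℝ) ^ t ≤ 8 ^ t := pow_le_pow_left₀ (by norm_num) (by norm_num) t
    have h41 : 4 * (D + 1) ≤ 8 * D := by linarith
    simp only [errB, Nat.cast_succ]
    calc D * (4 * (D + 1) * errB D t + 4 * (4 * D) ^ t)
        = 4 * (D + 1) * (D * errB D t) + 4 * D * (4 ^ t * D ^ t) := by rw [mul_pow]; ring
      _ ≤ 4 * (D + 1) * (t * 8 ^ t * D ^ t) + 4 * D * (8 ^ t * D ^ t) :=
          add_le_add (mul_le_mul_of_nonneg_left ih (by positivity))
            (mul_le_mul_of_nonneg_left (mul_le_mul_of_nonneg_right h4 hDt) (by positivity))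
      _ ≤ 8 * D * (t * 8 ^ t * D ^ t) + 8 * D * (8 ^ t * D ^ t) :=
          add_le_add (mul_le_mul_of_nonneg_right h41 (by positivity))
            (mul_le_mul_of_nonneg_right (by linarith) (by positivity))
      _ = (t + 1) * 8 ^ (t + 1) * D ^ (t + 1) := by ring

/-- One product step of the error analysis: `|w r − A (D R)| ≤ e (D + 1) + M` when
`|w − A| ≤ e`, `|A| ≤ M·`… precisely: `|w − A| ≤ e`, `|r − D R| ≤ 1`, `|R| ≤ 1`, `|A| ≤ M`. [folklore] -/
theorem abs_mul_sub_mul_le_step {w r A R D e M : ℝ} (hw : |w - A| ≤ e) (hr : |r - D * R| ≤ 1)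
    (hR : |R| ≤ 1) (hA : |A| ≤ M) (hD : 0 ≤ D) (he : 0 ≤ e) (hM : 0 ≤ M) :
    |w * r - A * (D * R)| ≤ e * (D + 1) + M := by
  have h1 : w * r - A * (D * R) = (w - A) * r + A * (r - D * R) := by ring
  have hr' : |r| ≤ D + 1 := by
    calc |r| = |(r - D * R) + D * R| := by ring_nf
      _ ≤ |r - D * R| + |D * R| := abs_add_le _ _
      _ ≤ 1 + D * 1 := add_le_add hr (by rw [abs_mul, abs_of_nonneg hD]; gcongr)
      _ = D + 1 := by ring
  rw [h1]
  calc |(w - A) * r + A * (r - D * R)| ≤ |(w - A) * r| + |A * (r - D * R)| := abs_add_le _ _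
    _ = |w - A| * |r| + |A| * |r - D * R| := by rw [abs_mul, abs_mul]
    _ ≤ e * (D + 1) + M * 1 := add_le_add (mul_le_mul hw hr' (abs_nonneg _) he)
        (mul_le_mul hA hr (abs_nonneg _) hM)
    _ = e * (D + 1) + M := by ring

/-- The real data of a gate datum (position, exact block). [folklore] -/
def realData (g : ℕ × Matrix LIdx LIdx ℝ × List ℤ) : ℕ × Matrix LIdx LIdx ℝ := (g.1, g.2.1)

/-- The integer data of a gate datum (position, approximant block). [folklore] -/
def intData (g : ℕ × Matrix LIdx LIdx ℝ × List ℤ) : ℕ × List ℤ := (g.1, g.2.2)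

/-- **The error invariant of the integer rows**: after `t` gates,
`|w_t(q) − D^t v_t(q)| ≤ e_t` for every Majorana index `q`, provided every block sits inside the
register, the exact blocks have entries `≤ 1` and the integer blocks approximate `D ·` the exact
ones to within `1`. [folklore] -/
theorem abs_rowList_sub_le (N : ℕ) (b : Bool) (D : ℕ) :
    ∀ (gs : List (ℕ × Matrix LIdx LIdx ℝ × List ℤ)),
    (∀ g ∈ gs, g.1 + 2 ≤ N) → (∀ g ∈ gs, ∀ μ ν, |g.2.1 μ ν| ≤ 1) →
    (∀ g ∈ gs, ∀ μ ν, |(blockOfList g.2.2 μ ν : ℝ) - D * g.2.1 μ ν| ≤ 1) →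
    ∀ q, |(rowFun (rowList D N b (gs.map intData)) q : ℝ) -
      (D : ℝ) ^ gs.length * rowExact N b (gs.map realData) q| ≤ errB D gs.length
  | [], _, _, _, q => by
    simp only [List.map_nil, rowList, rowExact, rowFun_initList, List.length_nil, pow_zero, one_mul, errB]
    split_ifs <;> simp
  | g :: gs, hj, hR, hr, q => by
    have ih := abs_rowList_sub_le N b D gs (fun g' hg' => hj g' (List.mem_cons_of_mem _ hg'))
      (fun g' hg' => hR g' (List.mem_cons_of_mem _ hg')) (fun g' hg' => hr g' (List.mem_cons_of_mem _ hg'))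
    have hg := hj g List.mem_cons_self
    have hv := abs_rowExact_le N b (gs.map realData)
      (fun g' hg' => by obtain ⟨g'', hg'', rfl⟩ := List.mem_map.1 hg'; exact hj g'' (List.mem_cons_of_mem _ hg''))
      (fun g' hg' => by obtain ⟨g'', hg'', rfl⟩ := List.mem_map.1 hg'; exact hR g'' (List.mem_cons_of_mem _ hg''))
    have hD0 : (0 : ℝ) ≤ D := Nat.cast_nonneg D
    have he0 : 0 ≤ errB (D : ℝ) gs.length := errB_nonneg hD0 _
    rw [List.length_map] at hv
    simp only [List.map_cons, rowList, rowExact, intData, realData, List.length_cons]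
    rw [rowFun_stepList (D : ℤ) hg g.2.2 (length_rowList _ _ _ _) q, vecMul_embE_apply g.1 hg]
    by_cases hq : InBlock g.1 q.1
    · rw [if_pos hq, if_pos hq, Int.cast_sum, mul_sum, ← sum_sub_distrib, errB,
        show (4 * ((D : ℝ) + 1) * errB (D : ℝ) gs.length + 4 * (4 * (D : ℝ)) ^ gs.length : ℝ) =
          4 * (errB (D : ℝ) gs.length * ((D : ℝ) + 1) + (D : ℝ) ^ gs.length * 4 ^ gs.length) by rw [mul_pow]; ring]
      refine abs_sum_lIdx_le fun μ => ?_
      rw [Int.cast_mul, show ∀ a c : ℝ, (D : ℝ) ^ (gs.length + 1) * (a * c) =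
          ((D : ℝ) ^ gs.length * a) * ((D : ℝ) * c) from fun a c => by ring]
      refine abs_mul_sub_mul_le_step (ih _) (hr g List.mem_cons_self _ _) (hR g List.mem_cons_self _ _)
        ?_ hD0 he0 (by positivity)
      rw [abs_mul, abs_of_nonneg (by positivity : (0 : ℝ) ≤ (D : ℝ) ^ gs.length)]
      exact mul_le_mul_of_nonneg_left (hv _) (by positivity)
    · rw [if_neg hq, if_neg hq, Int.cast_mul, Int.cast_natCast, pow_succ, errB]
      rw [show (D : ℝ) * (rowFun (rowList (↑D) N b (List.map intData gs)) q : ℝ) -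
          (D : ℝ) ^ gs.length * D * rowExact N b (List.map realData gs) q =
          D * ((rowFun (rowList (↑D) N b (List.map intData gs)) q : ℝ) -
            (D : ℝ) ^ gs.length * rowExact N b (List.map realData gs) q) by ring, abs_mul, abs_of_nonneg hD0]
      calc (D : ℝ) * |((rowFun (rowList (↑D) N b (List.map intData gs)) q : ℝ) -
            (D : ℝ) ^ gs.length * rowExact N b (List.map realData gs) q)| ≤ D * errB D gs.length :=
            mul_le_mul_of_nonneg_left (ih q) hD0
        _ ≤ 4 * (D + 1) * errB D gs.length + 4 * (4 * D) ^ gs.length := by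
            nlinarith [he0, pow_nonneg (by positivity : (0:ℝ) ≤ 4 * D) gs.length]


/-! ### The read-out and the final estimate -/

/-- Products of approximants: `|w w' − A A'| ≤ e (2M + e)`. [folklore] -/
theorem abs_mul_sub_mul_le_prod {w w' A A' e M : ℝ} (hw : |w - A| ≤ e) (hw' : |w' - A'| ≤ e)
    (hA : |A| ≤ M) (hA' : |A'| ≤ M) (he : 0 ≤ e) (hM : 0 ≤ M) : |w * w' - A * A'| ≤ e * (2 * M + e) := by
  have h1 : w * w' - A * A' = (w - A) * w' + A * (w' - A') := by ring
  have hw'b : |w'| ≤ M + e := by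
    calc |w'| = |(w' - A') + A'| := by ring_nf
      _ ≤ |w' - A'| + |A'| := abs_add_le _ _
      _ ≤ e + M := add_le_add hw' hA'
      _ = M + e := add_comm _ _
  rw [h1]
  calc |(w - A) * w' + A * (w' - A')| ≤ |(w - A) * w'| + |A * (w' - A')| := abs_add_le _ _
    _ = |w - A| * |w'| + |A| * |w' - A'| := by rw [abs_mul, abs_mul]
    _ ≤ e * (M + e) + M * e := add_le_add (mul_le_mul hw hw'b (abs_nonneg _) he) (mul_le_mul hA hw' (abs_nonneg _) hM)
    _ = e * (2 * M + e) := by ring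

/-- List sums over `range` are `Finset` sums. [folklore] -/
private theorem sum_map_range' {M : Type*} [AddCommMonoid M] (f : ℕ → M) (n : ℕ) :
    ((List.range n).map f).sum = ∑ i ∈ range n, f i := by
  induction n with
  | zero => simp
  | succ n ih => rw [List.range_succ, List.map_append, List.sum_append, ih, sum_range_succ]; simp

/-- The integer read-out as a sum over the wires. [folklore] -/
theorem zExpInt_eq_sum (y : List Bool) (N : ℕ) (w₀ w₁ : List ℤ) :
    zExpInt y N w₀ w₁ = ∑ i : Fin N, sgnOf y i *
      (rowFun w₀ ((i, false) : MIdx N) * rowFun w₁ ((i, true) : MIdx N) -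
        rowFun w₀ ((i, true) : MIdx N) * rowFun w₁ ((i, false) : MIdx N)) := by
  rw [zExpInt, sum_map_range', ← Fin.sum_univ_eq_sum_range]
  rfl

/-- **The read-out error**: `|S̃ − D^{2T} ⟨Z₀⟩| ≤ 2N e_T (2 (4D)^T + e_T)`. [folklore] -/
theorem abs_zExpInt_sub_le {N : ℕ} (D : ℕ) (x : Cryptography.QReg N) (y : List Bool)
    (hxy : ∀ i : Fin N, x i = y.getD i false)
    (gs : List (ℕ × Matrix LIdx LIdx ℝ × List ℤ))
    (hj : ∀ g ∈ gs, g.1 + 2 ≤ N) (hR : ∀ g ∈ gs, ∀ μ ν, |g.2.1 μ ν| ≤ 1)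
    (hr : ∀ g ∈ gs, ∀ μ ν, |(blockOfList g.2.2 μ ν : ℝ) - D * g.2.1 μ ν| ≤ 1) :
    |(zExpInt y N (rowList D N false (gs.map intData)) (rowList D N true (gs.map intData)) : ℝ) -
      ((D : ℝ) ^ gs.length) ^ 2 * zExp x (rowExact N false (gs.map realData)) (rowExact N true (gs.map realData))| ≤
      2 * N * (errB D gs.length * (2 * ((D : ℝ) ^ gs.length * 4 ^ gs.length) + errB D gs.length)) := by
  set e := errB (D : ℝ) gs.length with he
  set M := (D : ℝ) ^ gs.length * 4 ^ gs.length with hM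
  have he0 : 0 ≤ e := errB_nonneg (Nat.cast_nonneg D) _
  have hM0 : 0 ≤ M := by positivity
  have hw := fun b => abs_rowList_sub_le N b D gs hj hR hr
  have hv : ∀ b q, |(D : ℝ) ^ gs.length * rowExact N b (gs.map realData) q| ≤ M := by
    intro b q
    have h := abs_rowExact_le N b (gs.map realData)
      (fun g' hg' => by obtain ⟨g'', hg'', rfl⟩ := List.mem_map.1 hg'; exact hj g'' hg'')
      (fun g' hg' => by obtain ⟨g'', hg'', rfl⟩ := List.mem_map.1 hg'; exact hR g'' hg'') q
    rw [List.length_map] at h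
    rw [abs_mul, abs_of_nonneg (by positivity : (0 : ℝ) ≤ (D : ℝ) ^ gs.length), hM]
    exact mul_le_mul_of_nonneg_left h (by positivity)
  rw [zExpInt_eq_sum, zExp, Int.cast_sum, mul_sum, ← sum_sub_distrib]
  calc |∑ i : Fin N, _| ≤ ∑ i : Fin N, |((sgnOf y i *
          (rowFun (rowList D N false (gs.map intData)) ((i, false) : MIdx N) *
            rowFun (rowList D N true (gs.map intData)) ((i, true) : MIdx N) -
           rowFun (rowList D N false (gs.map intData)) ((i, true) : MIdx N) *
            rowFun (rowList D N true (gs.map intData)) ((i, false) : MIdx N)) : ℤ) : ℝ) -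
          ((D : ℝ) ^ gs.length) ^ 2 * ((if x i then -1 else 1) *
            (rowExact N false (gs.map realData) (i, false) * rowExact N true (gs.map realData) (i, true) -
              rowExact N false (gs.map realData) (i, true) * rowExact N true (gs.map realData) (i, false)))| :=
        abs_sum_le_sum_abs _ _
    _ ≤ ∑ _i : Fin N, 2 * (e * (2 * M + e)) := sum_le_sum fun i _ => ?_
    _ = 2 * N * (e * (2 * M + e)) := by rw [sum_const, card_univ, Fintype.card_fin]; simp; ring
  -- one wire
  have hs : ((sgnOf y i : ℤ) : ℝ) = (if x i then -1 else 1) := by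
    rw [sgnOf, hxy i]; split_ifs <;> simp
  set w₀ := rowList (D : ℤ) N false (gs.map intData)
  set w₁ := rowList (D : ℤ) N true (gs.map intData)
  set v₀ := rowExact N false (gs.map realData)
  set v₁ := rowExact N true (gs.map realData)
  have key : ((sgnOf y i * (rowFun w₀ ((i, false) : MIdx N) * rowFun w₁ ((i, true) : MIdx N) -
        rowFun w₀ ((i, true) : MIdx N) * rowFun w₁ ((i, false) : MIdx N)) : ℤ) : ℝ) -
      ((D : ℝ) ^ gs.length) ^ 2 * ((if x i then -1 else 1) * (v₀ (i, false) * v₁ (i, true) - v₀ (i, true) * v₁ (i, false))) =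
      (if x i then -1 else 1) *
        (((rowFun w₀ ((i, false) : MIdx N) : ℝ) * rowFun w₁ ((i, true) : MIdx N) -
            ((D : ℝ) ^ gs.length * v₀ (i, false)) * ((D : ℝ) ^ gs.length * v₁ (i, true))) -
          ((rowFun w₀ ((i, true) : MIdx N) : ℝ) * rowFun w₁ ((i, false) : MIdx N) -
            ((D : ℝ) ^ gs.length * v₀ (i, true)) * ((D : ℝ) ^ gs.length * v₁ (i, false)))) := by
    push_cast; rw [hs]; ring
  rw [key, abs_mul]
  have hsg : |(if x i then -1 else 1 : ℝ)| = 1 := by split_ifs <;> simp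
  rw [hsg, one_mul]
  calc _ ≤ |(rowFun w₀ ((i, false) : MIdx N) : ℝ) * rowFun w₁ ((i, true) : MIdx N) -
            ((D : ℝ) ^ gs.length * v₀ (i, false)) * ((D : ℝ) ^ gs.length * v₁ (i, true))| +
          |(rowFun w₀ ((i, true) : MIdx N) : ℝ) * rowFun w₁ ((i, false) : MIdx N) -
            ((D : ℝ) ^ gs.length * v₀ (i, true)) * ((D : ℝ) ^ gs.length * v₁ (i, false))| := abs_sub _ _
    _ ≤ e * (2 * M + e) + e * (2 * M + e) := add_le_add
        (abs_mul_sub_mul_le_prod (hw false _) (hw true _) (hv false _) (hv true _) he0 hM0)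
        (abs_mul_sub_mul_le_prod (hw false _) (hw true _) (hv false _) (hv true _) he0 hM0)
    _ = 2 * (e * (2 * M + e)) := by ring

/-- **Rounding**: `|⌊(z + Q)/(2Q)⌋ − z/(2Q)| ≤ ½` for `Q > 0`. [folklore] -/
theorem abs_round_div_sub_le (z : ℤ) {Q : ℤ} (hQ : 0 < Q) :
    |(((z + Q) / (2 * Q) : ℤ) : ℝ) - (z : ℝ) / (2 * Q)| ≤ 1 / 2 := by
  have h2Q : (0 : ℤ) < 2 * Q := by omega
  have h1 : ((z + Q) / (2 * Q) : ℤ) * (2 * Q) ≤ z + Q := Int.ediv_mul_le _ h2Q.ne'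
  have h2 : z + Q < ((z + Q) / (2 * Q) + 1) * (2 * Q) := Int.lt_ediv_add_one_mul_self _ h2Q
  set a : ℤ := (z + Q) / (2 * Q)
  have hQr : (0 : ℝ) < Q := by exact_mod_cast hQ
  have h1r : (a : ℝ) * (2 * Q) ≤ z + Q := by exact_mod_cast h1
  have h2r : (z : ℝ) + Q < ((a : ℝ) + 1) * (2 * Q) := by exact_mod_cast h2
  rw [abs_le]
  constructor
  · -- a ≥ (z+Q)/(2Q) - 1 = z/(2Q) - 1/2
    have : (z : ℝ) / (2 * Q) - 1 / 2 < a := by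
      rw [div_sub_div _ _ (by positivity) (by norm_num), div_lt_iff₀ (by positivity)]; nlinarith
    linarith
  · have : (a : ℝ) ≤ (z : ℝ) / (2 * Q) + 1 / 2 := by
      rw [div_add_div _ _ (by positivity) (by norm_num), le_div_iff₀ (by positivity)]; nlinarith
    linarith

/-- **The precision requirement**: `6 N T² 64^T 2^k ≤ D` makes the accumulated error at most half
a unit in the last place: `2^k · 2N e_T (2 (4D)^T + e_T) ≤ D^{2T}`. [folklore] -/
theorem err_le_of_precision {N T k D : ℕ} (hD : 6 * N * T ^ 2 * 64 ^ T * 2 ^ k ≤ D) (hD1 : 1 ≤ D) :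
    (2 : ℝ) ^ k * (2 * N * (errB D T * (2 * ((D : ℝ) ^ T * 4 ^ T) + errB D T))) ≤ ((D : ℝ) ^ T) ^ 2 := by
  have hD1r : (1 : ℝ) ≤ D := by exact_mod_cast hD1
  have hD0 : (0 : ℝ) ≤ D := zero_le_one.trans hD1r
  have he := mul_errB_le hD1r T          -- D e ≤ T 8^T D^T
  have he0 : 0 ≤ errB (D : ℝ) T := errB_nonneg hD0 T
  have hDr : (6 : ℝ) * N * T ^ 2 * 64 ^ T * 2 ^ k ≤ D := by exact_mod_cast hD
  rcases Nat.eq_zero_or_pos T with rfl | hT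
  · simp [errB]
  · have hT1 : (1 : ℝ) ≤ T := by exact_mod_cast hT
    have h4 : (4 : ℝ) ^ T ≤ 8 ^ T := pow_le_pow_left₀ (by norm_num) (by norm_num) T
    have h8 : (0 : ℝ) < 8 ^ T := by positivity
    have hDT : (0 : ℝ) < (D : ℝ) ^ T := by positivity
    -- D e ≤ T 8^T D^T  ⇒  D (2M + e) ≤ D·2·4^T D^T + T 8^T D^T ≤ 3 T 8^T D^T · D ... work with X := D e
    -- Goal·D²:  2^k 2N (De) (2 D M + D e) ≤ D^{2T} D² ; (De) ≤ A := T 8^T D^T, 2DM ≤ 2 D 8^T D^T ≤ 2 A D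
    set A : ℝ := T * 8 ^ T * (D : ℝ) ^ T with hA
    have hA0 : 0 ≤ A := by positivity
    have hX : (D : ℝ) * errB D T ≤ A := he
    have key : (D : ℝ) * ((D : ℝ) * (2 ^ k * (2 * N * (errB D T * (2 * ((D : ℝ) ^ T * 4 ^ T) + errB D T))))) ≤
        (D : ℝ) * ((D : ℝ) * (((D : ℝ) ^ T) ^ 2)) := by
      have h1 : (D : ℝ) * ((D : ℝ) * (2 ^ k * (2 * N * (errB D T * (2 * ((D : ℝ) ^ T * 4 ^ T) + errB D T))))) =
          2 ^ k * (2 * N) * ((D * errB D T) * (2 * D * ((D : ℝ) ^ T * 4 ^ T) + D * errB D T)) := by ring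
      rw [h1]
      have h2 : (D : ℝ) * errB D T * (2 * D * ((D : ℝ) ^ T * 4 ^ T) + D * errB D T) ≤ A * (2 * D * A + A) := by
        have h3' : (D : ℝ) ^ T * 4 ^ T ≤ A := by
          rw [hA]
          calc (D : ℝ) ^ T * 4 ^ T ≤ (D : ℝ) ^ T * 8 ^ T := mul_le_mul_of_nonneg_left h4 hDT.le
            _ = 1 * 8 ^ T * (D : ℝ) ^ T := by ring
            _ ≤ T * 8 ^ T * (D : ℝ) ^ T := by gcongr
        have h3 : 2 * (D : ℝ) * ((D : ℝ) ^ T * 4 ^ T) ≤ 2 * D * A := mul_le_mul_of_nonneg_left h3' (by positivity)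
        calc (D : ℝ) * errB D T * (2 * D * ((D : ℝ) ^ T * 4 ^ T) + D * errB D T)
            ≤ A * (2 * D * ((D : ℝ) ^ T * 4 ^ T) + D * errB D T) :=
              mul_le_mul_of_nonneg_right hX (by positivity)
          _ ≤ A * (2 * D * A + A) := mul_le_mul_of_nonneg_left (add_le_add h3 hX) hA0
      calc 2 ^ k * (2 * N) * ((D * errB D T) * (2 * D * ((D : ℝ) ^ T * 4 ^ T) + D * errB D T))
          ≤ 2 ^ k * (2 * N) * (A * (2 * D * A + A)) := mul_le_mul_of_nonneg_left h2 (by positivity)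
        _ ≤ 2 ^ k * (2 * N) * (A * (3 * D * A)) := by
            apply mul_le_mul_of_nonneg_left _ (by positivity)
            apply mul_le_mul_of_nonneg_left _ hA0
            nlinarith
        _ = (6 * N * T ^ 2 * 64 ^ T * 2 ^ k) * (D * ((D : ℝ) ^ T) ^ 2) := by
            rw [hA, show (64 : ℝ) = 8 ^ 2 by norm_num, ← pow_mul]; ring
        _ ≤ D * (D * ((D : ℝ) ^ T) ^ 2) := mul_le_mul_of_nonneg_right hDr (by positivity)
    have hDpos : (0 : ℝ) < D := by positivity
    exact le_of_mul_le_mul_left (le_of_mul_le_mul_left key hDpos) hDpos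

/-- **Main numerical theorem.** For a register of `N ≥ 1` wires, a basis input `x` (listed as
`y`), gate data `(j_t, R_t, r_t)` with blocks inside the register, exact blocks `R_t` with entries
`≤ 1` in absolute value and integer blocks `r_t` with `|r_t − D R_t| ≤ 1` entrywise, and a
precision `D ≥ 6 N T² 64^T 2^k`, the integer estimate is within one unit of `2^k p₁`,
`p₁ = (1 − ⟨Z₀⟩)/2` with `⟨Z₀⟩ = zExp x v₀ v₁` the bilinear read-out of the exact rows
(JM08 eq. (10)). [cite: JozsaMiyake2008, Thm 1 and §4 eq. (10)] -/
theorem abs_estOf_sub_le {N : ℕ} (hN : 0 < N) (k D : ℕ) (x : Cryptography.QReg N) (y : List Bool)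
    (hxy : ∀ i : Fin N, x i = y.getD i false)
    (gs : List (ℕ × Matrix LIdx LIdx ℝ × List ℤ))
    (hj : ∀ g ∈ gs, g.1 + 2 ≤ N) (hR : ∀ g ∈ gs, ∀ μ ν, |g.2.1 μ ν| ≤ 1)
    (hr : ∀ g ∈ gs, ∀ μ ν, |(blockOfList g.2.2 μ ν : ℝ) - D * g.2.1 μ ν| ≤ 1)
    (hD : 6 * N * gs.length ^ 2 * 64 ^ gs.length * 2 ^ k ≤ D) (hD1 : 1 ≤ D) :
    |(estOf k D N gs.length (zExpInt y N (rowList D N false (gs.map intData)) (rowList D N true (gs.map intData))) : ℝ) -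
      2 ^ k * ((1 - zExp x (rowExact N false (gs.map realData)) (rowExact N true (gs.map realData))) / 2)| ≤ 1 := by
  set T := gs.length
  set S : ℤ := zExpInt y N (rowList D N false (gs.map intData)) (rowList D N true (gs.map intData))
  set Z : ℝ := zExp x (rowExact N false (gs.map realData)) (rowExact N true (gs.map realData))
  have hQ : (0 : ℤ) < (D : ℤ) ^ (2 * T) := by positivity
  have hQr : (0 : ℝ) < (D : ℝ) ^ (2 * T) := by positivity
  have hround := abs_round_div_sub_le (2 ^ k * ((D : ℤ) ^ (2 * T) - S)) hQ
  have herr := abs_zExpInt_sub_le D x y hxy gs hj hR hr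
  have hprec := err_le_of_precision (N := N) (T := T) (k := k) hD hD1
  rw [estOf, if_neg hN.ne']
  set mid : ℝ := ((2 ^ k * ((D : ℤ) ^ (2 * T) - S) : ℤ) : ℝ) / (2 * ((D : ℤ) ^ (2 * T) : ℤ)) with hmid_def
  have hQ2 : (D : ℝ) ^ (2 * T) = ((D : ℝ) ^ T) ^ 2 := by ring
  have hnum : (2 : ℝ) ^ k * |((D : ℝ) ^ T) ^ 2 * Z - S| ≤ ((D : ℝ) ^ T) ^ 2 := by
    rw [abs_sub_comm]
    exact (mul_le_mul_of_nonneg_left herr (by positivity)).trans hprec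
  have hmid : |mid - 2 ^ k * ((1 - Z) / 2)| ≤ 1 / 2 := by
    have h1 : mid - 2 ^ k * ((1 - Z) / 2) = 2 ^ k * (((D : ℝ) ^ T) ^ 2 * Z - S) / (2 * ((D : ℝ) ^ T) ^ 2) := by
      rw [hmid_def]
      push_cast
      rw [hQ2]
      field_simp
      ring
    rw [h1, abs_div, abs_mul, abs_of_pos (by positivity : (0 : ℝ) < 2 ^ k),
      abs_of_pos (by positivity : (0 : ℝ) < 2 * ((D : ℝ) ^ T) ^ 2), div_le_iff₀ (by positivity)]
    linarith [hnum]
  calc _ ≤ |(((2 ^ k * ((D : ℤ) ^ (2 * T) - S) + (D : ℤ) ^ (2 * T)) / (2 * (D : ℤ) ^ (2 * T)) : ℤ) : ℝ) - mid| +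
          |mid - 2 ^ k * ((1 - Z) / 2)| := abs_sub_le _ _ _
    _ ≤ 1 / 2 + 1 / 2 := add_le_add hround hmid
    _ = 1 := by norm_num


/-- **Main numerical theorem, probability form**: `|est / 2^k − p₁| ≤ 2^{-k}`.
[cite: JozsaMiyake2008, Thm 1 ("computed … to m digits of accuracy in poly(n, m) time")] -/
theorem abs_estOf_div_sub_le {N : ℕ} (hN : 0 < N) (k D : ℕ) (x : Cryptography.QReg N) (y : List Bool)
    (hxy : ∀ i : Fin N, x i = y.getD i false)
    (gs : List (ℕ × Matrix LIdx LIdx ℝ × List ℤ))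
    (hj : ∀ g ∈ gs, g.1 + 2 ≤ N) (hR : ∀ g ∈ gs, ∀ μ ν, |g.2.1 μ ν| ≤ 1)
    (hr : ∀ g ∈ gs, ∀ μ ν, |(blockOfList g.2.2 μ ν : ℝ) - D * g.2.1 μ ν| ≤ 1)
    (hD : 6 * N * gs.length ^ 2 * 64 ^ gs.length * 2 ^ k ≤ D) (hD1 : 1 ≤ D) :
    |(estOf k D N gs.length (zExpInt y N (rowList D N false (gs.map intData)) (rowList D N true (gs.map intData))) : ℝ) /
        2 ^ k - (1 - zExp x (rowExact N false (gs.map realData)) (rowExact N true (gs.map realData))) / 2| ≤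
      (1 / 2 : ℝ) ^ k := by
  have h := abs_estOf_sub_le hN k D x y hxy gs hj hR hr hD hD1
  have h2 : (0 : ℝ) < 2 ^ k := by positivity
  rw [show ∀ a p : ℝ, a / 2 ^ k - p = (a - 2 ^ k * p) / 2 ^ k from fun a p => by field_simp, abs_div,
    abs_of_pos h2, div_le_iff₀ h2, one_div_pow, one_div, inv_mul_cancel₀ h2.ne']
  exact h


end Numerics

section Program


open _root_.Computability Polynomial Literature.Computability.Complexity
  Literature.Computability.Complexity.CodeFP Literature.Computability.Complexity.Brick
  Literature.Computability.Cryptography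

/-! ### Sizes of the integers along the row recursion -/

/-- The sum of the magnitudes of a list of integers. [folklore] -/
def sabs (l : List ℤ) : ℕ := (l.map Int.natAbs).sum

/-- An item is below the sum of magnitudes. [folklore] -/
theorem natAbs_le_sabs {l : List ℤ} {x : ℤ} (h : x ∈ l) : x.natAbs ≤ sabs l :=
  List.single_le_sum (fun _ _ => Nat.zero_le _) _ (List.mem_map.2 ⟨x, h, rfl⟩)

/-- `getD` with default `0` is bounded by any bound on the items. [folklore] -/
theorem natAbs_getD_le {w : List ℤ} {B : ℕ} (h : ∀ x ∈ w, x.natAbs ≤ B) (i : ℕ) : (w.getD i 0).natAbs ≤ B := by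
  rw [List.getD_eq_getElem?_getD]
  cases hi : w[i]? with
  | none => simp
  | some a => exact h a (List.mem_of_getElem? hi)

/-- **Growth of one step**: entries of `stepList D j rl w` are at most `(|D| + 4 Σ|rl|) · B` when
those of `w` are at most `B`. [folklore] -/
theorem natAbs_stepList_le {D : ℤ} {j : ℕ} {rl w : List ℤ} {B : ℕ} (h : ∀ x ∈ w, x.natAbs ≤ B) :
    ∀ x ∈ stepList D j rl w, x.natAbs ≤ (D.natAbs + 4 * sabs rl) * B := by
  intro x hx
  obtain ⟨i, hi, rfl⟩ := List.mem_iff_getElem.1 hx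
  have hi' : i < w.length := by rwa [length_stepList] at hi
  have hx' : (stepList D j rl w)[i] = (stepList D j rl w).getD i 0 := by
    rw [List.getD_eq_getElem?_getD, List.getElem?_eq_getElem hi]; rfl
  rw [hx', getD_stepList D j rl w hi']
  have hw := natAbs_getD_le h
  have hr : ∀ i, (rl.getD i 0).natAbs ≤ sabs rl := natAbs_getD_le fun x hx => natAbs_le_sabs hx
  split_ifs with hb
  · have ht : ∀ μ : LIdx, (w.getD (2 * j + lflat μ) 0 * rl.getD (4 * lflat μ + (i - 2 * j)) 0).natAbs ≤ B * sabs rl := by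
      intro μ; rw [Int.natAbs_mul]; exact Nat.mul_le_mul (hw _) (hr _)
    have h0 := ht (0, false); have h1 := ht (0, true); have h2 := ht (1, false); have h3 := ht (1, true)
    rw [sum4]
    refine (Int.natAbs_add_le _ _).trans ?_
    have e1 := Int.natAbs_add_le (w.getD (2 * j + lflat (0, false)) 0 * rl.getD (4 * lflat (0, false) + (i - 2 * j)) 0 +
      w.getD (2 * j + lflat (0, true)) 0 * rl.getD (4 * lflat (0, true) + (i - 2 * j)) 0)
      (w.getD (2 * j + lflat (1, false)) 0 * rl.getD (4 * lflat (1, false) + (i - 2 * j)) 0)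
    have e2 := Int.natAbs_add_le (w.getD (2 * j + lflat (0, false)) 0 * rl.getD (4 * lflat (0, false) + (i - 2 * j)) 0)
      (w.getD (2 * j + lflat (0, true)) 0 * rl.getD (4 * lflat (0, true) + (i - 2 * j)) 0)
    have key : (D.natAbs + 4 * sabs rl) * B = D.natAbs * B + 4 * (B * sabs rl) := by ring
    rw [key]
    omega
  · rw [Int.natAbs_mul]
    exact Nat.mul_le_mul (Nat.le_add_right _ _) (hw i)

/-- **Growth along the fold**: after the gate data `l`, entries are at most
`(∏_{g ∈ l} (|D| + 4 Σ|rl_g|)) · B`. [folklore] -/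
theorem natAbs_foldl_stepList_le (D : ℤ) : ∀ (l : List (ℕ × List ℤ)) (w : List ℤ) (B : ℕ),
    (∀ x ∈ w, x.natAbs ≤ B) → ∀ x ∈ l.foldl (fun w g => stepList D g.1 g.2 w) w,
      x.natAbs ≤ (l.map fun g => D.natAbs + 4 * sabs g.2).prod * B
  | [], w, B, h, x, hx => by
    rw [List.foldl_nil] at hx
    rw [List.map_nil, List.prod_nil, one_mul]
    exact h x hx
  | g :: l, w, B, h, x, hx => by
    rw [List.foldl_cons] at hx
    have := natAbs_foldl_stepList_le D l _ _ (natAbs_stepList_le h) x hx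
    rw [List.map_cons, List.prod_cons]
    calc x.natAbs ≤ (l.map fun g => D.natAbs + 4 * sabs g.2).prod * ((D.natAbs + 4 * sabs g.2) * B) := this
      _ = (D.natAbs + 4 * sabs g.2) * (l.map fun g => D.natAbs + 4 * sabs g.2).prod * B := by ring

/-- The binary size of a product is at most the sum of the sizes. [folklore] -/
theorem size_list_prod_le (l : List ℕ) : Nat.size l.prod ≤ (l.map Nat.size).sum + 1 := by
  induction l with
  | nil => simp
  | cons a l ih => rw [List.prod_cons, List.map_cons, List.sum_cons]; exact (size_mul_le _ _).trans (by omega)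

/-- The size of `Σ|rl|` is at most twice the code of `rl`. [folklore] -/
theorem size_sabs_le (rl : List ℤ) : Nat.size (sabs rl) ≤ 2 * (rawE intE rl).length := by
  have h1 : Nat.size (sabs rl) ≤ (rl.map Int.natAbs).length + (rawE intE rl).length :=
    size_sum_le fun x hx => by
      obtain ⟨z, hz, rfl⟩ := List.mem_map.1 hx
      exact (size_natAbs_le_length_intE z).trans ((by omega : (intE z).length ≤ 2 * (intE z).length + 2).trans
        (length_item_le_length_rawE intE hz))
  have h2 := length_le_length_rawE intE rl
  rw [List.length_map] at h1
  omega

/-- The size of one growth factor. [folklore] -/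
theorem size_factor_le (D : ℤ) (rl : List ℤ) :
    Nat.size (D.natAbs + 4 * sabs rl) ≤ (intE D).length + 2 * (rawE intE rl).length + 4 := by
  have h1 := size_add_le D.natAbs (4 * sabs rl)
  have h2 := size_mul_le 4 (sabs rl)
  have h3 : Nat.size 4 = 3 := by decide
  have h4 := size_natAbs_le_length_intE D
  have h5 := size_sabs_le rl
  have h6 : max (Nat.size D.natAbs) (Nat.size (4 * sabs rl)) ≤ Nat.size D.natAbs + Nat.size (4 * sabs rl) := max_le (by omega) (by omega)
  omega

/-- The codes of the blocks are within the code of the gate data. [folklore] -/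
theorem sum_length_rawE_le : ∀ l : List (ℕ × List ℤ),
    (l.map fun g => (rawE intE g.2).length).sum ≤ (rawE (pairE natE (rawE intE)) l).length
  | [] => by simp
  | g :: l => by
    rw [List.map_cons, List.sum_cons, rawE_cons, length_boolPair, pairE_apply, length_boolPair]
    have := sum_length_rawE_le l
    omega

/-- A raw list code with item codes at most `c` has length at most `|l| (2c + 2)`. [folklore] -/
theorem length_rawE_le_of_forall {α : Type} (e : α → List Bool) {l : List α} {c : ℕ}
    (h : ∀ a ∈ l, (e a).length ≤ c) : (rawE e l).length ≤ l.length * (2 * c + 2) := by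
  induction l with
  | nil => simp
  | cons a l ih =>
    rw [rawE_cons, length_boolPair, List.length_cons]
    have ha := h a List.mem_cons_self
    have := ih fun x hx => h x (List.mem_cons_of_mem _ hx)
    nlinarith

/-- The fold preserves the length of the row. [folklore] -/
theorem length_foldl_stepList (D : ℤ) : ∀ (l : List (ℕ × List ℤ)) (w : List ℤ),
    (l.foldl (fun w g => stepList D g.1 g.2 w) w).length = w.length
  | [], w => rfl
  | g :: l, w => by rw [List.foldl_cons, length_foldl_stepList D l, length_stepList]

/-- Entries of the initial row are `0` or `1`. [folklore] -/
theorem natAbs_initList_le (N : ℕ) (b : Bool) : ∀ x ∈ initList N b, x.natAbs ≤ 1 := by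
  intro x hx
  simp only [initList, List.mem_map, List.mem_range] at hx
  obtain ⟨p, -, rfl⟩ := hx
  split_ifs <;> simp

/-- The context code of the row fold: `(D, N, b)`. -/
local notation "ctxE" => (pairE intE (pairE unE bitE) : ℤ × ℕ × Bool → List Bool)

/-- The gate-datum code: `(j, rl)`. -/
local notation "gdE" => (pairE natE (rawE intE) : ℕ × List ℤ → List Bool)

/-- **The accumulator of the row fold stays polynomially bounded**: with `ℓ` the length of the whole
input code, every intermediate row has a code of length at most `12ℓ³ + 72ℓ² + 24ℓ`. [folklore] -/
theorem length_rawE_foldl_stepList_le (s : ℤ × ℕ × Bool) (l₁ l₂ : List (ℕ × List ℤ)) :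
    (rawE intE (l₁.foldl (fun w g => stepList s.1 g.1 g.2 w) (initList s.2.1 s.2.2))).length ≤
      (12 * X ^ 3 + 72 * X ^ 2 + 24 * X : Polynomial ℕ).eval (pairE ctxE (rawE gdE) (s, l₁ ++ l₂)).length := by
  obtain ⟨D, N, b⟩ := s
  set ℓ := (pairE ctxE (rawE gdE) ((D, N, b), l₁ ++ l₂)).length with hℓ
  have hℓ' : ℓ = 2 * (2 * (intE D).length + 2 + (2 * (unE N).length + 2 + (bitE b).length)) + 2 +
      (rawE gdE (l₁ ++ l₂)).length := by
    simp only [hℓ, pairE_apply, length_boolPair]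
  rw [length_unE] at hℓ'
  have hl₁ : (rawE gdE l₁).length ≤ (rawE gdE (l₁ ++ l₂)).length :=
    length_rawE_le_of_sublist gdE (List.sublist_append_left l₁ l₂)
  have hlen₁ : l₁.length ≤ ℓ := (length_le_length_rawE gdE l₁).trans (by omega)
  have hD : (intE D).length ≤ ℓ := by omega
  have hN : N ≤ ℓ := by omega
  have hcodes : (l₁.map fun g => (rawE intE g.2).length).sum ≤ ℓ := (sum_length_rawE_le l₁).trans (by omega)
  -- the bound on the entries
  set w := l₁.foldl (fun w g => stepList D g.1 g.2 w) (initList N b) with hw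
  have hB := natAbs_foldl_stepList_le D l₁ (initList N b) 1 (natAbs_initList_le N b)
  rw [mul_one] at hB
  set P := (l₁.map fun g => D.natAbs + 4 * sabs g.2).prod with hP
  have hsizeP : Nat.size P ≤ ℓ * (ℓ + 4) + 2 * ℓ + 1 := by
    refine (size_list_prod_le _).trans ?_
    rw [List.map_map]
    have h1 : ((l₁.map fun g => D.natAbs + 4 * sabs g.2).map Nat.size).sum ≤
        (l₁.map fun g => ((intE D).length + 4) + 2 * (rawE intE g.2).length).sum := by
      rw [List.map_map]
      exact List.sum_le_sum fun g _ => by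
        have := size_factor_le D g.2
        simp only [Function.comp_apply]; omega
    have h2 : (l₁.map fun g => ((intE D).length + 4) + 2 * (rawE intE g.2).length).sum =
        l₁.length * ((intE D).length + 4) + 2 * (l₁.map fun g => (rawE intE g.2).length).sum := by
      rw [List.sum_map_add, List.sum_map_mul_left, List.map_const', List.sum_replicate, smul_eq_mul]
    rw [List.map_map] at h1
    have h3 : l₁.length * ((intE D).length + 4) ≤ ℓ * (ℓ + 4) := Nat.mul_le_mul hlen₁ (by omega)
    simp only [Function.comp_def] at h1 h2 ⊢
    omega
  -- each entry
  have hentry : ∀ x ∈ w, (intE x).length ≤ 3 * (ℓ * (ℓ + 4) + 2 * ℓ + 1) + 2 := fun x hx => by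
    have h1 := length_dpEnc_le x
    have h2 : Nat.size x.natAbs ≤ Nat.size P := size_mono (hB x hx)
    change (dpEnc x).length ≤ _
    omega
  have hwlen : w.length = 2 * N := by rw [hw, length_foldl_stepList, length_initList]
  refine (length_rawE_le_of_forall intE hentry).trans ?_
  rw [hwlen]
  simp only [eval_add, eval_mul, eval_pow, eval_X, eval_ofNat]
  calc 2 * N * (2 * (3 * (ℓ * (ℓ + 4) + 2 * ℓ + 1) + 2) + 2) ≤ 2 * ℓ * (2 * (3 * (ℓ * (ℓ + 4) + 2 * ℓ + 1) + 2) + 2) :=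
        Nat.mul_le_mul_right _ (Nat.mul_le_mul_left 2 hN)
    _ = 12 * ℓ ^ 3 + 72 * ℓ ^ 2 + 24 * ℓ := by ring

/-! ### The row recursion on codes -/

section Step

/-- The argument code of one entry update: `(((D, j), (rl, w)), (p, x))`. -/
local notation "stE" => (pairE (pairE (pairE intE natE) (pairE (rawE intE) (rawE intE))) (pairE natE intE) :
  ((ℤ × ℕ) × (List ℤ × List ℤ)) × ℕ × ℤ → List Bool)

/-- The four flat local positions. [folklore] -/
theorem lflat_vals : lflat (0, false) = 0 ∧ lflat (0, true) = 1 ∧ lflat (1, false) = 2 ∧ lflat (1, true) = 3 :=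
  ⟨rfl, rfl, rfl, rfl⟩

/-- The new entry at position `p` (old entry `x`) of one step, as a function of the whole argument.
[folklore] -/
def stepEntry (t : ((ℤ × ℕ) × (List ℤ × List ℤ)) × ℕ × ℤ) : ℤ :=
  if 2 * t.1.1.2 ≤ t.2.1 ∧ t.2.1 < 2 * t.1.1.2 + 4 then
    sum4 (fun μ => t.1.2.2.getD (2 * t.1.1.2 + lflat μ) 0 * t.1.2.1.getD (4 * lflat μ + (t.2.1 - 2 * t.1.1.2)) 0)
  else t.1.1.1 * t.2.2

/-- **One entry update on codes.** [cite: AroraBarak2009, §1.3] -/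
theorem stepEntry_codeFP : CodeFP stE intE stepEntry := by
  have hD : CodeFP stE intE (fun t => t.1.1.1) := (fst _ _).fst'.fst'
  have hj : CodeFP stE natE (fun t => t.1.1.2) := (fst _ _).fst'.snd'
  have hrl : CodeFP stE (rawE intE) (fun t => t.1.2.1) := (fst _ _).snd'.fst'
  have hw : CodeFP stE (rawE intE) (fun t => t.1.2.2) := (fst _ _).snd'.snd'
  have hp : CodeFP stE natE (fun t => t.2.1) := (snd _ _).fst'
  have hx : CodeFP stE intE (fun t => t.2.2) := (snd _ _).snd'
  have h2j : CodeFP stE natE (fun t => 2 * t.1.1.2) := (natMul.comp ((const _ 2).pair hj) :)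
  have htest : CodeFP stE bitE (fun t => decide (2 * t.1.1.2 ≤ t.2.1) && decide (t.2.1 < 2 * t.1.1.2 + 4)) :=
    ((natLe.comp (h2j.pair hp)).and (natLt.comp (hp.pair (natAdd.comp (h2j.pair (const _ 4))))) :)
  have hsub : CodeFP stE natE (fun t => t.2.1 - 2 * t.1.1.2) := (natSub.comp (hp.pair h2j) :)
  have hterm : ∀ c : ℕ, CodeFP stE intE
      (fun t => t.1.2.2.getD (2 * t.1.1.2 + c) 0 * t.1.2.1.getD (4 * c + (t.2.1 - 2 * t.1.1.2)) 0) := fun c =>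
    (intMul.comp (((rawGetOr intE).comp (hw.pair ((natAdd.comp (h2j.pair (const _ c))).pair (const _ (0 : ℤ))))).pair
      ((rawGetOr intE).comp (hrl.pair ((natAdd.comp ((const _ (4 * c)).pair hsub)).pair (const _ (0 : ℤ)))))) :)
  have hsum : CodeFP stE intE (fun t =>
      t.1.2.2.getD (2 * t.1.1.2 + 0) 0 * t.1.2.1.getD (4 * 0 + (t.2.1 - 2 * t.1.1.2)) 0 +
      t.1.2.2.getD (2 * t.1.1.2 + 1) 0 * t.1.2.1.getD (4 * 1 + (t.2.1 - 2 * t.1.1.2)) 0 +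
      t.1.2.2.getD (2 * t.1.1.2 + 2) 0 * t.1.2.1.getD (4 * 2 + (t.2.1 - 2 * t.1.1.2)) 0 +
      t.1.2.2.getD (2 * t.1.1.2 + 3) 0 * t.1.2.1.getD (4 * 3 + (t.2.1 - 2 * t.1.1.2)) 0) :=
    (intAdd.comp ((intAdd.comp ((intAdd.comp ((hterm 0).pair (hterm 1))).pair (hterm 2))).pair (hterm 3)) :)
  have helse : CodeFP stE intE (fun t => t.1.1.1 * t.2.2) := (intMul.comp (hD.pair hx) :)
  refine (htest.ite hsum helse).congr fun t => ?_
  simp only [stepEntry, sum4, lflat_vals.1, lflat_vals.2.1, lflat_vals.2.2.1, lflat_vals.2.2.2, Bool.and_eq_true,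
    decide_eq_true_eq]

/-- **One step on codes**: `((D, j), (rl, w)) ↦ stepList D j rl w`. [cite: AroraBarak2009, §1.3] -/
theorem stepList_codeFP : CodeFP (pairE (pairE intE natE) (pairE (rawE intE) (rawE intE))) (rawE intE)
    (fun s => stepList s.1.1 s.1.2 s.2.1 s.2.2) := by
  have h := mapIdx (σ := (ℤ × ℕ) × (List ℤ × List ℤ)) (eσ := pairE (pairE intE natE) (pairE (rawE intE) (rawE intE)))
    (eα := intE) (g := stepEntry) stepEntry_codeFP
  refine (h.comp ((CodeFP.id _).pair (snd _ _).snd')).congr fun s => ?_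
  rfl

end Step

/-- The bit `b` as the numeral `0`/`1`. [folklore] -/
theorem bitToNat_codeFP : CodeFP bitE natE (fun b : Bool => if b then 1 else 0) :=
  ofFintype bitE_injective natE _

/-- **The initial row on codes**: `(N, b) ↦ initList N b`. [cite: AroraBarak2009, §1.3] -/
theorem initList_codeFP : CodeFP (pairE unE bitE) (rawE intE) (fun p => initList p.1 p.2) := by
  have hitem : CodeFP (pairE bitE natE) intE
      (fun q => if decide (q.2 = (if q.1 then 1 else 0)) then (1 : ℤ) else 0) :=
    ((natEq.comp ((snd _ _).pair (bitToNat_codeFP.comp (fst _ _)))).ite (const _ (1 : ℤ)) (const _ (0 : ℤ)) :)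
  have hmap := map (σ := Bool) (eσ := bitE) (eα := natE) (eβ := intE) hitem
  have hrange : CodeFP (pairE unE bitE) (rawE natE) (fun p => List.range (2 * p.1)) :=
    (urange.comp ((unMulConst 2).comp (fst _ _)) :)
  refine (hmap.comp ((snd _ _).pair hrange)).congr fun p => ?_
  simp only [initList, decide_eq_true_eq]

/-- `rowList` is the left fold over the reversed gate data. [folklore] -/
theorem rowList_eq_foldl_reverse (D : ℤ) (N : ℕ) (b : Bool) (gs : List (ℕ × List ℤ)) :
    rowList D N b gs = gs.reverse.foldl (fun w g => stepList D g.1 g.2 w) (initList N b) := by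
  rw [List.foldl_reverse]
  induction gs with
  | nil => rfl
  | cons g gs ih => rw [rowList, List.foldr_cons, ih]

/-- **The integer rows on codes**: `((D, N, b), gs) ↦ rowList D N b gs`. [cite: AroraBarak2009, §1.3 (polynomially bounded loops)] -/
theorem rowList_codeFP : CodeFP (pairE ctxE (rawE gdE)) (rawE intE) (fun p => rowList p.1.1 p.1.2.1 p.1.2.2 p.2) := by
  have hstep : CodeFP (pairE ctxE (pairE gdE (rawE intE))) (rawE intE) (fun t => stepList t.1.1 t.2.1.1 t.2.1.2 t.2.2) :=
    (stepList_codeFP.comp ((((fst _ _).fst').pair (snd _ _).fst'.fst').pair ((snd _ _).fst'.snd'.pair (snd _ _).snd')) :)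
  have hinit : CodeFP ctxE (rawE intE) (fun s : ℤ × ℕ × Bool => initList s.2.1 s.2.2) :=
    (initList_codeFP.comp ((snd _ _).fst'.pair (snd _ _).snd') :)
  have hfold := foldl (σ := ℤ × ℕ × Bool) (α := ℕ × List ℤ) (β := List ℤ) (eσ := ctxE) (eα := gdE) (eβ := rawE intE)
    (step := fun s g w => stepList s.1 g.1 g.2 w) (init := fun s => initList s.2.1 s.2.2) hstep hinit
    (12 * X ^ 3 + 72 * X ^ 2 + 24 * X) (fun s l₁ l₂ => length_rawE_foldl_stepList_le s l₁ l₂)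
  refine ((hfold.comp ((fst _ _).pair ((rawReverse gdE).comp (snd _ _)))).congr fun p => ?_)
  simp only [rowList_eq_foldl_reverse]

/-! ### The read-out and the estimate on codes -/

/-- **The integer read-out on codes**: `(y, (N, (w₀, w₁))) ↦ zExpInt y N w₀ w₁`. [cite: AroraBarak2009, §1.3] -/
theorem zExpInt_codeFP : CodeFP (pairE strE (pairE unE (pairE (rawE intE) (rawE intE)))) intE
    (fun p => zExpInt p.1 p.2.1 p.2.2.1 p.2.2.2) := by
  -- context `(y, (w₀, w₁))`, item `i`
  have hy : CodeFP (pairE (pairE strE (pairE (rawE intE) (rawE intE))) natE) strE (fun t => t.1.1) := (fst _ _).fst'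
  have hw0 : CodeFP (pairE (pairE strE (pairE (rawE intE) (rawE intE))) natE) (rawE intE) (fun t => t.1.2.1) := (fst _ _).snd'.fst'
  have hw1 : CodeFP (pairE (pairE strE (pairE (rawE intE) (rawE intE))) natE) (rawE intE) (fun t => t.1.2.2) := (fst _ _).snd'.snd'
  have hi : CodeFP (pairE (pairE strE (pairE (rawE intE) (rawE intE))) natE) natE (fun t => t.2) := snd _ _
  have h2i : CodeFP (pairE (pairE strE (pairE (rawE intE) (rawE intE))) natE) natE (fun t => 2 * t.2) :=
    (natMul.comp ((const _ 2).pair hi) :)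
  have h2i1 : CodeFP (pairE (pairE strE (pairE (rawE intE) (rawE intE))) natE) natE (fun t => 2 * t.2 + 1) :=
    (natAdd.comp (h2i.pair (const _ 1)) :)
  have hget : ∀ {w : (List Bool × List ℤ × List ℤ) × ℕ → List ℤ} {ix : (List Bool × List ℤ × List ℤ) × ℕ → ℕ},
      CodeFP (pairE (pairE strE (pairE (rawE intE) (rawE intE))) natE) (rawE intE) w →
      CodeFP (pairE (pairE strE (pairE (rawE intE) (rawE intE))) natE) natE ix →
      CodeFP (pairE (pairE strE (pairE (rawE intE) (rawE intE))) natE) intE (fun t => (w t).getD (ix t) 0) :=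
    fun hw hix => ((rawGetOr intE).comp (hw.pair (hix.pair (const _ (0 : ℤ)))) :)
  have hsgn : CodeFP (pairE (pairE strE (pairE (rawE intE) (rawE intE))) natE) intE (fun t => sgnOf t.1.1 t.2) :=
    ((strGetDNat.comp (hy.pair hi)).ite (const _ (-1 : ℤ)) (const _ (1 : ℤ))).congr fun t => by simp [sgnOf]
  have hitem : CodeFP (pairE (pairE strE (pairE (rawE intE) (rawE intE))) natE) intE (fun t => sgnOf t.1.1 t.2 *
      ((t.1.2.1.getD (2 * t.2) 0) * (t.1.2.2.getD (2 * t.2 + 1) 0) - (t.1.2.1.getD (2 * t.2 + 1) 0) * (t.1.2.2.getD (2 * t.2) 0))) :=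
    (intMul.comp (hsgn.pair (intSub.comp ((intMul.comp ((hget hw0 h2i).pair (hget hw1 h2i1))).pair
      (intMul.comp ((hget hw0 h2i1).pair (hget hw1 h2i)))))) :)
  have hmap := map (σ := List Bool × List ℤ × List ℤ) (eσ := pairE strE (pairE (rawE intE) (rawE intE))) (eα := natE) (eβ := intE) hitem
  have hrange : CodeFP (pairE strE (pairE unE (pairE (rawE intE) (rawE intE)))) (rawE natE) (fun p => List.range p.2.1) :=
    (urange.comp (snd _ _).fst' :)
  have hctx : CodeFP (pairE strE (pairE unE (pairE (rawE intE) (rawE intE)))) (pairE strE (pairE (rawE intE) (rawE intE)))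
      (fun p => (p.1, p.2.2)) := (fst _ _).pair (snd _ _).snd'
  refine ((intSum.comp (hmap.comp (hctx.pair hrange))).congr fun p => ?_)
  simp only [zExpInt]

/-- The estimate with an integer precision parameter (`estOf` casts a natural one). [folklore] -/
def estOfZ (k : ℕ) (D : ℤ) (N T : ℕ) (S : ℤ) : ℤ :=
  if N = 0 then 0 else (2 ^ k * (D ^ (2 * T) - S) + D ^ (2 * T)) / (2 * D ^ (2 * T))

/-- `estOf` through `estOfZ`. [folklore] -/
theorem estOf_eq_estOfZ (k D N T : ℕ) (S : ℤ) : estOf k D N T S = estOfZ k D N T S := rfl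

/-- **The estimate on codes**: `(k, (D, (N, (T, S)))) ↦ estOfZ k D N T S`. [cite: AroraBarak2009, §1.3] -/
theorem estOfZ_codeFP : CodeFP (pairE unE (pairE intE (pairE unE (pairE unE intE)))) intE
    (fun p => estOfZ p.1 p.2.1 p.2.2.1 p.2.2.2.1 p.2.2.2.2) := by
  have hk : CodeFP (pairE unE (pairE intE (pairE unE (pairE unE intE)))) unE (fun p => p.1) := fst _ _
  have hD : CodeFP (pairE unE (pairE intE (pairE unE (pairE unE intE)))) intE (fun p => p.2.1) := (snd _ _).fst'
  have hN : CodeFP (pairE unE (pairE intE (pairE unE (pairE unE intE)))) unE (fun p => p.2.2.1) := (snd _ _).snd'.fst'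
  have hT : CodeFP (pairE unE (pairE intE (pairE unE (pairE unE intE)))) unE (fun p => p.2.2.2.1) := (snd _ _).snd'.snd'.fst'
  have hS : CodeFP (pairE unE (pairE intE (pairE unE (pairE unE intE)))) intE (fun p => p.2.2.2.2) := (snd _ _).snd'.snd'.snd'
  have hQ : CodeFP (pairE unE (pairE intE (pairE unE (pairE unE intE)))) intE (fun p => p.2.1 ^ (2 * p.2.2.2.1)) :=
    (intPow.comp (hD.pair ((unMulConst 2).comp hT)) :)
  have h2k : CodeFP (pairE unE (pairE intE (pairE unE (pairE unE intE)))) intE (fun p => (2 : ℤ) ^ p.1) :=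
    (intPow.comp ((const _ (2 : ℤ)).pair hk) :)
  have hnum : CodeFP (pairE unE (pairE intE (pairE unE (pairE unE intE)))) intE
      (fun p => (2 : ℤ) ^ p.1 * (p.2.1 ^ (2 * p.2.2.2.1) - p.2.2.2.2) + p.2.1 ^ (2 * p.2.2.2.1)) :=
    (intAdd.comp ((intMul.comp (h2k.pair (intSub.comp (hQ.pair hS)))).pair hQ) :)
  have hden : CodeFP (pairE unE (pairE intE (pairE unE (pairE unE intE)))) intE (fun p => 2 * p.2.1 ^ (2 * p.2.2.2.1)) :=
    (intMul.comp ((const _ (2 : ℤ)).pair hQ) :)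
  have htest : CodeFP (pairE unE (pairE intE (pairE unE (pairE unE intE)))) bitE (fun p => decide (p.2.2.1 = 0)) :=
    (natEq.comp ((natOfUn.comp hN).pair (const _ 0)) :)
  refine (htest.ite (const _ (0 : ℤ)) (intEDiv.comp (hnum.pair hden))).congr fun p => ?_
  simp only [estOfZ, decide_eq_true_eq]

/-! ### Gate codes -/

/-- The symbol numeral of a gate code (`QGate.encode`: the tag bit dropped, first field). [folklore] -/
def symOfCode (w : List Bool) : ℕ := bitsToNat (fstF (w.drop 1))

/-- The first wire of a gate code (first item of the wire list, the second field). [folklore] -/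
def wire0OfCode (w : List Bool) : ℕ := bitsToNat (fstF (sndF (sndF (w.drop 1))))

/-- The second wire of a gate code. [folklore] -/
def wire1OfCode (w : List Bool) : ℕ := bitsToNat (fstF (sndF (sndF (sndF (w.drop 1)))))

/-- `fstF` on codes. [folklore] -/
theorem fstF_codeFP : CodeFP strE strE fstF := CodeFP.of_fn fstF fstF_mem_FP fun _ => rfl

/-- `sndF` on codes. [folklore] -/
theorem sndF_codeFP : CodeFP strE strE sndF := CodeFP.of_fn sndF sndF_mem_FP fun _ => rfl

/-- Dropping the tag bit. [folklore] -/
theorem dropOne_codeFP : CodeFP strE strE (fun w : List Bool => w.drop 1) :=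
  (strDrop.comp ((const strE 1).pair (CodeFP.id strE)) :)

/-- `symOfCode` on codes. [cite: AroraBarak2009, §1.3] -/
theorem symOfCode_codeFP : CodeFP strE natE symOfCode := (strVal.comp (fstF_codeFP.comp dropOne_codeFP) :)

/-- `wire0OfCode` on codes. [cite: AroraBarak2009, §1.3] -/
theorem wire0OfCode_codeFP : CodeFP strE natE wire0OfCode :=
  (strVal.comp (fstF_codeFP.comp (sndF_codeFP.comp (sndF_codeFP.comp dropOne_codeFP))) :)

/-- `wire1OfCode` on codes. [cite: AroraBarak2009, §1.3] -/
theorem wire1OfCode_codeFP : CodeFP strE natE wire1OfCode :=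
  (strVal.comp (fstF_codeFP.comp (sndF_codeFP.comp (sndF_codeFP.comp (sndF_codeFP.comp dropOne_codeFP)))) :)

section GateSet

variable {Op : Type} [Encodable Op] {M : Op → Matrix (QReg 2) (QReg 2) ℂ} {N : ℕ}

/-- The code of a placed gate of a matchgate circuit. [folklore] -/
theorem encode_gate (g : Op) (e : Fin 2 ↪ Fin N) :
    (QGate.gate g e : QGate (gateSet Op M) N).encode =
      false :: boolPair (natE (Encodable.encode g)) (boolPair (unE 2) (boolPair (natE (e 0)) (boolPair (natE (e 1)) []))) := by
  rw [QGate.encode]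
  congr 2

/-- The symbol of a placed gate. [folklore] -/
theorem symOfCode_encode (g : Op) (e : Fin 2 ↪ Fin N) :
    symOfCode (QGate.gate g e : QGate (gateSet Op M) N).encode = Encodable.encode g := by
  rw [encode_gate, symOfCode, List.drop_one, List.tail_cons, fstF_boolPair, bitsToNat_natE]

/-- The first wire of a placed gate. [folklore] -/
theorem wire0OfCode_encode (g : Op) (e : Fin 2 ↪ Fin N) :
    wire0OfCode (QGate.gate g e : QGate (gateSet Op M) N).encode = e 0 := by
  rw [encode_gate, wire0OfCode, List.drop_one, List.tail_cons, sndF_boolPair, sndF_boolPair, fstF_boolPair, bitsToNat_natE]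

/-- The second wire of a placed gate. [folklore] -/
theorem wire1OfCode_encode (g : Op) (e : Fin 2 ↪ Fin N) :
    wire1OfCode (QGate.gate g e : QGate (gateSet Op M) N).encode = e 1 := by
  rw [encode_gate, wire1OfCode, List.drop_one, List.tail_cons, sndF_boolPair, sndF_boolPair, sndF_boolPair, fstF_boolPair,
    bitsToNat_natE]

end GateSet

/-! ### The gate data read off a gate code through a rotation table -/

/-- **The numerical datum of a gate code**: the block position `min(a, b)` of its two wires and the
integer block looked up in the rotation table `tab` at (symbol, orientation `a < b`, precision `L`).
[folklore] -/
def gdOf (tab : ℕ → Bool → ℕ → List ℤ) (L : ℕ) (w : List Bool) : ℕ × List ℤ :=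
  (min (wire0OfCode w) (wire1OfCode w), tab (symOfCode w) (decide (wire0OfCode w < wire1OfCode w)) L)

/-- `gdOf` on codes, for a table computed on codes. [cite: AroraBarak2009, §1.3] -/
theorem gdOf_codeFP {tab : ℕ → Bool → ℕ → List ℤ}
    (htab : CodeFP (pairE natE (pairE bitE unE)) (rawE intE) (fun t => tab t.1 t.2.1 t.2.2)) :
    CodeFP (pairE unE strE) gdE (fun p => gdOf tab p.1 p.2) := by
  have hw : CodeFP (pairE unE strE) strE (fun p => p.2) := snd _ _
  have h0 : CodeFP (pairE unE strE) natE (fun p => wire0OfCode p.2) := wire0OfCode_codeFP.comp hw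
  have h1 : CodeFP (pairE unE strE) natE (fun p => wire1OfCode p.2) := wire1OfCode_codeFP.comp hw
  have hs : CodeFP (pairE unE strE) natE (fun p => symOfCode p.2) := symOfCode_codeFP.comp hw
  exact ((natMin.comp (h0.pair h1)).pair (htab.comp (hs.pair ((natLt.comp (h0.pair h1)).pair (fst _ _)))) :)

/-! ### The estimator on parsed instances -/

/-- The parsed form of an instance: `((n, m, gate codes), input bits, k)`. -/
local notation "PI" => ((ℕ × ℕ × List (List Bool)) × List Bool × ℕ)

/-- Its code: `⟨⟨bin n, ⟨1^m, codes⟩⟩, ⟨x, 1^k⟩⟩` — literally `Instance.encode`. -/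
local notation "piE" => (pairE (pairE natE (pairE unE (rawE strE))) (pairE strE unE) : PI → List Bool)

/-- Number of wires `N = |x| + m`. [folklore] -/
def nWires (P : PI) : ℕ := P.2.1.length + P.1.2.1

/-- Number of gates `T`. [folklore] -/
def nGates (P : PI) : ℕ := P.1.2.2.length

/-- **The precision** `L = k + 8T + N + 3` (so that `2^L ≥ 6 N T² 64^T 2^k`). [folklore] -/
def precOf (P : PI) : ℕ := P.2.2 + 8 * nGates P + nWires P + 3

/-- The gate data of all gate codes. [folklore] -/
def gateData (tab : ℕ → Bool → ℕ → List ℤ) (P : PI) : List (ℕ × List ℤ) := P.1.2.2.map (gdOf tab (precOf P))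

/-- **The estimator on a parsed instance**: precision, rows, read-out, rounding. [cite: JozsaMiyake2008, Thm 1] -/
def estParsed (tab : ℕ → Bool → ℕ → List ℤ) (P : PI) : ℤ :=
  estOfZ P.2.2 ((2 : ℤ) ^ precOf P) (nWires P) (nGates P)
    (zExpInt P.2.1 (nWires P) (rowList ((2 : ℤ) ^ precOf P) (nWires P) false (gateData tab P))
      (rowList ((2 : ℤ) ^ precOf P) (nWires P) true (gateData tab P)))

/-- **The estimator on parsed instances is computed on codes in polynomial time.** [cite: AroraBarak2009, §1.3] -/
theorem estParsed_codeFP {tab : ℕ → Bool → ℕ → List ℤ}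
    (htab : CodeFP (pairE natE (pairE bitE unE)) (rawE intE) (fun t => tab t.1 t.2.1 t.2.2)) :
    CodeFP piE intE (estParsed tab) := by
  have hm : CodeFP piE unE (fun P => P.1.2.1) := (fst _ _).snd'.fst'
  have hcodes : CodeFP piE (rawE strE) (fun P => P.1.2.2) := (fst _ _).snd'.snd'
  have hx : CodeFP piE strE (fun P => P.2.1) := (snd _ _).fst'
  have hk : CodeFP piE unE (fun P => P.2.2) := (snd _ _).snd'
  have hN : CodeFP piE unE nWires := (unAdd.comp ((strLength.comp hx).pair hm) :)
  have hT : CodeFP piE unE nGates := ((ulength strE).comp hcodes :)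
  have hL : CodeFP piE unE precOf :=
    (unAdd.comp ((unAdd.comp ((unAdd.comp (hk.pair ((unMulConst 8).comp hT))).pair hN)).pair (const _ 3)) :)
  have hD : CodeFP piE intE (fun P => (2 : ℤ) ^ precOf P) := (intPow.comp ((const _ (2 : ℤ)).pair hL) :)
  have hgd : CodeFP piE (rawE gdE) (gateData tab) :=
    ((map (σ := ℕ) (eσ := unE) (eα := strE) (gdOf_codeFP htab)).comp (hL.pair hcodes) :)
  have hrow : ∀ b : Bool, CodeFP piE (rawE intE)
      (fun P => rowList ((2 : ℤ) ^ precOf P) (nWires P) b (gateData tab P)) := fun b =>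
    (rowList_codeFP.comp ((hD.pair (hN.pair (const _ b))).pair hgd) :)
  have hS : CodeFP piE intE (fun P => zExpInt P.2.1 (nWires P) (rowList ((2 : ℤ) ^ precOf P) (nWires P) false (gateData tab P))
      (rowList ((2 : ℤ) ^ precOf P) (nWires P) true (gateData tab P))) :=
    (zExpInt_codeFP.comp (hx.pair (hN.pair ((hrow false).pair (hrow true)))) :)
  exact (estOfZ_codeFP.comp (hk.pair (hD.pair (hN.pair (hT.pair hS)))) :)

/-! ### The estimator on instances -/

section Instances

variable {Op : Type} [Encodable Op] {M : Op → Matrix (QReg 2) (QReg 2) ℂ}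

/-- The parsed form of an instance. [folklore] -/
def Instance.parsed (i : Instance Op M) : PI := ((i.n, i.m, i.circ.gates.map QGate.encode), List.ofFn i.x, i.k)

/-- **The instance code IS the code of the parsed form.** [folklore] -/
theorem Instance.encode_eq_parsed (i : Instance Op M) : i.encode = piE i.parsed := by
  rw [Instance.encode, Instance.parsed, QCircuit.sigmaEncode, QCircuit.encode_eq_encList]
  simp only [pairE_apply, rawE, strE, List.map_id]
  rfl

/-- Parsing is the identity on codes. [folklore] -/
theorem Instance.parsed_codeFP : CodeFP Instance.encode piE (Instance.parsed (Op := Op) (M := M)) :=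
  transparent fun i => (Instance.encode_eq_parsed i).symm

/-- **The estimator** of a table `tab`, on instances. [cite: JozsaMiyake2008, Thm 1] -/
def estInstance (tab : ℕ → Bool → ℕ → List ℤ) (i : Instance Op M) : ℤ := estParsed tab i.parsed

/-- **The estimator runs in polynomial time** in the length of the instance code (output in the
sign-magnitude integer format `encodingIntBool`), for every table computed on codes.
[cite: AroraBarak2009, §1.3] -/
theorem estInstance_polyTime {tab : ℕ → Bool → ℕ → List ℤ}
    (htab : CodeFP (pairE natE (pairE bitE unE)) (rawE intE) (fun t => tab t.1 t.2.1 t.2.2)) :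
    PolyTimeComputable Instance.encode encodingIntBool.encode (estInstance (Op := Op) (M := M) tab) :=
  (smOfInt.comp ((estParsed_codeFP htab).comp Instance.parsed_codeFP)).polyTimeComputable

/-- The gate datum of a placed gate. [folklore] -/
theorem gdOf_encode_gate {N : ℕ} (tab : ℕ → Bool → ℕ → List ℤ) (L : ℕ) (g : Op) (e : Fin 2 ↪ Fin N) :
    gdOf tab L (QGate.gate g e : QGate (gateSet Op M) N).encode =
      (min (e 0 : ℕ) (e 1), tab (Encodable.encode g) (decide ((e 0 : ℕ) < e 1)) L) := by
  rw [gdOf, symOfCode_encode, wire0OfCode_encode, wire1OfCode_encode]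

/-- **What the estimator computes**, in the vocabulary of `MatchgateNumerics.lean`: with
`N = n + m`, `T` the number of gates, `L = k + 8T + N + 3` and the gate data read off the gate
codes, `est = estOf k 2^L N T (zExpInt x N w₀ w₁)` for the integer rows `w_b = rowList 2^L N b`.
[folklore] -/
theorem estInstance_eq (tab : ℕ → Bool → ℕ → List ℤ) (i : Instance Op M) :
    estInstance tab i = estOf i.k (2 ^ (i.k + 8 * i.circ.gates.length + (i.n + i.m) + 3)) (i.n + i.m) i.circ.gates.length
      (zExpInt (List.ofFn i.x) (i.n + i.m)
        (rowList ((2 : ℤ) ^ (i.k + 8 * i.circ.gates.length + (i.n + i.m) + 3)) (i.n + i.m) false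
          (i.circ.gates.map fun g => gdOf tab (i.k + 8 * i.circ.gates.length + (i.n + i.m) + 3) g.encode))
        (rowList ((2 : ℤ) ^ (i.k + 8 * i.circ.gates.length + (i.n + i.m) + 3)) (i.n + i.m) true
          (i.circ.gates.map fun g => gdOf tab (i.k + 8 * i.circ.gates.length + (i.n + i.m) + 3) g.encode))) := by
  have hN : nWires i.parsed = i.n + i.m := by simp [nWires, Instance.parsed]
  have hT : nGates i.parsed = i.circ.gates.length := by simp [nGates, Instance.parsed]
  have hL : precOf i.parsed = i.k + 8 * i.circ.gates.length + (i.n + i.m) + 3 := by rw [precOf, hN, hT]; rfl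
  have hG : gateData tab i.parsed = i.circ.gates.map fun g => gdOf tab (i.k + 8 * i.circ.gates.length + (i.n + i.m) + 3) g.encode := by
    rw [gateData, hL]; simp [Instance.parsed, List.map_map, Function.comp_def]
  rw [estInstance, estParsed, estOf_eq_estOfZ, hN, hT, hL, hG]
  push_cast
  rfl

end Instances


end Program

section RotationTable


open _root_.Computability Polynomial Literature.Computability.Complexity
  Literature.Computability.Complexity.CodeFP Literature.Computability.Cryptography Matrix

/-! ### The rotation entries are polynomial-time computable reals -/

/-- The entries of the four matrices `α_p` are in `C̃`. [folklore] -/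
theorem isPolyTimeComputableComplex_pauli (p : LIdx) (i j : Fin 2) : IsPolyTimeComputableComplex (pauli p i j) := by
  rcases lIdx_cases p with rfl | rfl | rfl | rfl <;> fin_cases i <;> fin_cases j <;>
    simp [pauli, isPolyTimeComputableComplex_zero, isPolyTimeComputableComplex_one, isPolyTimeComputableComplex_I,
      isPolyTimeComputableComplex_I.neg, isPolyTimeComputableComplex_one.neg]

/-- Products of `2 × 2` matrices with entries in `C̃` have entries in `C̃`. [folklore] -/
theorem isPolyTimeComputableComplex_mul_apply {A B : Matrix (Fin 2) (Fin 2) ℂ}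
    (hA : ∀ i j, IsPolyTimeComputableComplex (A i j)) (hB : ∀ i j, IsPolyTimeComputableComplex (B i j)) (i j : Fin 2) :
    IsPolyTimeComputableComplex ((A * B) i j) := by
  rw [Matrix.mul_apply]
  exact IsPolyTimeComputableComplex.finset_sum _ _ fun k _ => (hA i k).mul (hB k j)

/-- Conjugate transposes of matrices with entries in `C̃` have entries in `C̃`. [folklore] -/
theorem isPolyTimeComputableComplex_conjTranspose_apply {m n : Type*} {A : Matrix m n ℂ}
    (hA : ∀ i j, IsPolyTimeComputableComplex (A i j)) (i : n) (j : m) :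
    IsPolyTimeComputableComplex (Aᴴ i j) := by
  rw [conjTranspose_apply, Complex.star_def]
  exact (hA j i).conj

/-- The Pauli coefficients of a matrix with entries in `C̃` are in `C̃`. [folklore] -/
theorem isPolyTimeComputableComplex_coef {W : Matrix (Fin 2) (Fin 2) ℂ} (hW : ∀ i j, IsPolyTimeComputableComplex (W i j))
    (p : LIdx) : IsPolyTimeComputableComplex (coef W p) := by
  rw [coef, trace_fin_two, div_eq_mul_inv, show ((2 : ℂ)⁻¹) = (((1 / 2 : ℚ) : ℝ) : ℂ) by push_cast; ring]
  have h := isPolyTimeComputableComplex_mul_apply hW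
    (isPolyTimeComputableComplex_conjTranspose_apply (isPolyTimeComputableComplex_pauli p))
  exact ((h 0 0).add (h 1 1)).mul (IsPolyTimeComputableComplex.ofReal (IsPolyTimeComputableReal.ratCast' _))

/-- **The rotation of an allowable pair with entries in `C̃` has entries in `P_ℝ`.** [folklore] -/
theorem isPolyTimeComputableReal_rot2 {A B : Matrix (Fin 2) (Fin 2) ℂ}
    (hA : ∀ i j, IsPolyTimeComputableComplex (A i j)) (hB : ∀ i j, IsPolyTimeComputableComplex (B i j)) (μ ν : LIdx) :
    IsPolyTimeComputableReal (rot2 A B μ ν) := by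
  rw [rot2, of_apply]
  refine (isPolyTimeComputableComplex_coef (fun i j => ?_) ν).re
  exact isPolyTimeComputableComplex_mul_apply
    (isPolyTimeComputableComplex_mul_apply (isPolyTimeComputableComplex_conjTranspose_apply hA)
      (isPolyTimeComputableComplex_pauli μ)) hB i j

/-- **The rotation of a two-qubit gate with entries in `C̃` has entries in `P_ℝ`.** [folklore] -/
theorem isPolyTimeComputableReal_rotOf {U : Matrix (QReg 2) (QReg 2) ℂ}
    (hU : ∀ x y, IsPolyTimeComputableComplex (U x y)) (μ ν : LIdx) : IsPolyTimeComputableReal (rotOf U μ ν) :=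
  isPolyTimeComputableReal_rot2 (fun _ _ => hU _ _) (fun _ _ => hU _ _) μ ν

/-! ### The table of a gate alphabet -/

section Table

variable {Op : Type} {M : Op → Matrix (QReg 2) (QReg 2) ℂ}

/-- **The exact rotation of the gate symbol `g` in the orientation `dir`**: `rotOf (M g)` for the
forward orientation (wires `(j, j+1)`), `rotOf` of the wire-swapped gate for the backward one.
[cite: JozsaMiyake2008, Thm 3 and §2 (SWAP G(A,B) SWAP = G(A, XBX))] -/
noncomputable def rotDir (M : Op → Matrix (QReg 2) (QReg 2) ℂ) (g : Op) (dir : Bool) : Matrix LIdx LIdx ℝ :=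
  if dir then rotOf (M g) else rotOf ((M g).submatrix (fun x => x ∘ ⇑wireSwap) (fun x => x ∘ ⇑wireSwap))

/-- The entries of `rotDir` are polynomial-time computable reals when the gate entries are in `C̃`. [folklore] -/
theorem isPolyTimeComputableReal_rotDir (hM : ∀ g x y, IsPolyTimeComputableComplex (M g x y)) (g : Op) (dir : Bool)
    (μ ν : LIdx) : IsPolyTimeComputableReal (rotDir M g dir μ ν) := by
  unfold rotDir
  split_ifs
  · exact isPolyTimeComputableReal_rotOf (hM g) μ ν
  · exact isPolyTimeComputableReal_rotOf (fun x y => hM g _ _) μ ν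

/-- **The dyadic approximant function** of the entry `(μ, ν)` of `rotDir M g dir` (a choice of the
name promised by `IsPolyTimeComputableReal`). [cite: Ko1991, Def. 2.1] -/
noncomputable def approxFn (hM : ∀ g x y, IsPolyTimeComputableComplex (M g x y)) (g : Op) (dir : Bool) (μ ν : LIdx) : ℕ → ℤ :=
  Classical.choose (isPolyTimeComputableReal_rotDir hM g dir μ ν)

/-- The approximant function is polynomial-time from unary and `2^{-n}`-accurate. [cite: Ko1991, Def. 2.1] -/
theorem approxFn_spec (hM : ∀ g x y, IsPolyTimeComputableComplex (M g x y)) (g : Op) (dir : Bool) (μ ν : LIdx) :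
    PolyTimeComputable unaryEncodeNat encodingIntBool.encode (approxFn hM g dir μ ν) ∧
      ∀ n : ℕ, |rotDir M g dir μ ν - (approxFn hM g dir μ ν n : ℝ) / 2 ^ n| ≤ (1 / 2 : ℝ) ^ n :=
  Classical.choose_spec (isPolyTimeComputableReal_rotDir hM g dir μ ν)

/-- The approximant function on codes. [cite: AroraBarak2009, §1.3] -/
theorem approxFn_codeFP (hM : ∀ g x y, IsPolyTimeComputableComplex (M g x y)) (g : Op) (dir : Bool) (μ ν : LIdx) :
    CodeFP unE intE (approxFn hM g dir μ ν) :=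
  (intOfSM.comp (ofPolyTimeComputable_unE (approxFn_spec hM g dir μ ν).1) :)

/-- **The integer block** of `g` in orientation `dir` at precision `L`: the sixteen approximants
`approxFn … μ ν L ≈ 2^L (rotDir M g dir)_{μν}` in row-major flat order. [folklore] -/
noncomputable def blockApprox (hM : ∀ g x y, IsPolyTimeComputableComplex (M g x y)) (g : Op) (dir : Bool) (L : ℕ) : List ℤ :=
  [approxFn hM g dir (0, false) (0, false) L, approxFn hM g dir (0, false) (0, true) L,
    approxFn hM g dir (0, false) (1, false) L, approxFn hM g dir (0, false) (1, true) L,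
    approxFn hM g dir (0, true) (0, false) L, approxFn hM g dir (0, true) (0, true) L,
    approxFn hM g dir (0, true) (1, false) L, approxFn hM g dir (0, true) (1, true) L,
    approxFn hM g dir (1, false) (0, false) L, approxFn hM g dir (1, false) (0, true) L,
    approxFn hM g dir (1, false) (1, false) L, approxFn hM g dir (1, false) (1, true) L,
    approxFn hM g dir (1, true) (0, false) L, approxFn hM g dir (1, true) (0, true) L,
    approxFn hM g dir (1, true) (1, false) L, approxFn hM g dir (1, true) (1, true) L]

/-- The integer block read back as a matrix. [folklore] -/
theorem blockOfList_blockApprox (hM : ∀ g x y, IsPolyTimeComputableComplex (M g x y)) (g : Op) (dir : Bool) (L : ℕ)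
    (μ ν : LIdx) : blockOfList (blockApprox hM g dir L) μ ν = approxFn hM g dir μ ν L := by
  rcases lIdx_cases μ with rfl | rfl | rfl | rfl <;> rcases lIdx_cases ν with rfl | rfl | rfl | rfl <;> rfl

/-- The integer block on codes. [cite: AroraBarak2009, §1.3] -/
theorem blockApprox_codeFP (hM : ∀ g x y, IsPolyTimeComputableComplex (M g x y)) (g : Op) (dir : Bool) :
    CodeFP unE (rawE intE) (blockApprox hM g dir) := by
  have c : ∀ {f : ℕ → ℤ} {r : ℕ → List ℤ}, CodeFP unE intE f → CodeFP unE (rawE intE) r →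
      CodeFP unE (rawE intE) (fun L => f L :: r L) := fun hf hr => ((rawCons intE).comp (hf.pair hr) :)
  have a := approxFn_codeFP hM g dir
  exact c (a _ _) (c (a _ _) (c (a _ _) (c (a _ _) (c (a _ _) (c (a _ _) (c (a _ _) (c (a _ _)
    (c (a _ _) (c (a _ _) (c (a _ _) (c (a _ _) (c (a _ _) (c (a _ _) (c (a _ _) (c (a _ _) (const unE ([] : List ℤ)))))))))))))))))

section Encodable

variable [Encodable Op]

/-- The table of a list of symbols: the first symbol whose code is `sym` answers. [folklore] -/
noncomputable def tabOfList (hM : ∀ g x y, IsPolyTimeComputableComplex (M g x y)) : List Op → ℕ → Bool → ℕ → List ℤ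
  | [], _, _, _ => []
  | g :: gs, sym, dir, L => if sym = Encodable.encode g then blockApprox hM g dir L else tabOfList hM gs sym dir L

/-- **The rotation table** of the alphabet: `(sym, dir, L) ↦` the integer block of the symbol coded
by `sym` (the empty list for a non-code). [folklore] -/
noncomputable def rotTable [Fintype Op] (hM : ∀ g x y, IsPolyTimeComputableComplex (M g x y)) : ℕ → Bool → ℕ → List ℤ :=
  tabOfList hM Finset.univ.toList

/-- The table of a list answers with the block of a listed symbol. [folklore] -/
theorem tabOfList_encode (hM : ∀ g x y, IsPolyTimeComputableComplex (M g x y)) {l : List Op} {g : Op} (hg : g ∈ l)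
    (dir : Bool) (L : ℕ) : tabOfList hM l (Encodable.encode g) dir L = blockApprox hM g dir L := by
  induction l with
  | nil => exact absurd hg List.not_mem_nil
  | cons g' l ih =>
    rw [tabOfList]
    by_cases h : Encodable.encode g = Encodable.encode g'
    · rw [if_pos h, Encodable.encode_injective h]
    · rw [if_neg h]
      rcases List.mem_cons.1 hg with rfl | hg'
      · exact absurd rfl h
      · exact ih hg'

/-- **The table answers with the block of every symbol.** [folklore] -/
theorem rotTable_encode [Fintype Op] (hM : ∀ g x y, IsPolyTimeComputableComplex (M g x y)) (g : Op) (dir : Bool) (L : ℕ) :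
    rotTable hM (Encodable.encode g) dir L = blockApprox hM g dir L :=
  tabOfList_encode hM (Finset.mem_toList.2 (Finset.mem_univ g)) dir L

/-- The table of a list on codes. [cite: AroraBarak2009, §1.3] -/
theorem tabOfList_codeFP (hM : ∀ g x y, IsPolyTimeComputableComplex (M g x y)) :
    ∀ l : List Op, CodeFP (pairE natE (pairE bitE unE)) (rawE intE) (fun t => tabOfList hM l t.1 t.2.1 t.2.2)
  | [] => (const _ ([] : List ℤ)).congr fun t => by simp [tabOfList]
  | g :: l => by
    have hb : CodeFP (pairE natE (pairE bitE unE)) (rawE intE) (fun t => blockApprox hM g t.2.1 t.2.2) := by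
      refine ((((snd _ _).fst' :).ite ((blockApprox_codeFP hM g true).comp (snd _ _).snd')
        ((blockApprox_codeFP hM g false).comp (snd _ _).snd')).congr fun t => ?_)
      cases t.2.1 <;> rfl
    have ht : CodeFP (pairE natE (pairE bitE unE)) bitE (fun t => decide (t.1 = Encodable.encode g)) :=
      (natEq.comp ((fst _ _).pair (const _ (Encodable.encode g))) :)
    exact (ht.ite hb (tabOfList_codeFP hM l)).congr fun t => by simp only [tabOfList, decide_eq_true_eq]

/-- **The rotation table is computed on codes in polynomial time.** [cite: AroraBarak2009, §1.3] -/
theorem rotTable_codeFP [Fintype Op] (hM : ∀ g x y, IsPolyTimeComputableComplex (M g x y)) :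
    CodeFP (pairE natE (pairE bitE unE)) (rawE intE) (fun t => rotTable hM t.1 t.2.1 t.2.2) :=
  tabOfList_codeFP hM _

/-- **Table correctness**: the integer block of `g` approximates `2^L` times the exact rotation
to within one unit, entrywise. [cite: Ko1991, Def. 2.1] -/
theorem abs_rotTable_sub_le [Fintype Op] (hM : ∀ g x y, IsPolyTimeComputableComplex (M g x y)) (g : Op) (dir : Bool) (L : ℕ)
    (μ ν : LIdx) :
    |(blockOfList (rotTable hM (Encodable.encode g) dir L) μ ν : ℝ) - ((2 ^ L : ℕ) : ℝ) * rotDir M g dir μ ν| ≤ 1 := by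
  rw [rotTable_encode, blockOfList_blockApprox]
  have h := (approxFn_spec hM g dir μ ν).2 L
  have h2 : (0 : ℝ) < 2 ^ L := by positivity
  rw [show ∀ r a : ℝ, r - a / 2 ^ L = (2 ^ L * r - a) / 2 ^ L from fun r a => by field_simp, abs_div,
    abs_of_pos h2, div_le_iff₀ h2, one_div_pow, one_div, inv_mul_cancel₀ h2.ne'] at h
  push_cast
  rwa [abs_sub_comm]

/-! ### The estimator of the alphabet -/

/-- **The Jozsa–Miyake estimator** of the finite matchgate alphabet `M` with entries in `C̃`: the
string program of `MatchgateEstimatorFP.lean` run with the alphabet's rotation table.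
[cite: JozsaMiyake2008, Thm 1] -/
noncomputable def jmEst [Fintype Op] (hM : ∀ g x y, IsPolyTimeComputableComplex (M g x y)) : Instance Op M → ℤ :=
  estInstance (rotTable hM)

/-- **The Jozsa–Miyake estimator runs in polynomial time.** [cite: JozsaMiyake2008, Thm 1] -/
theorem jmEst_polyTime [Fintype Op] (hM : ∀ g x y, IsPolyTimeComputableComplex (M g x y)) :
    PolyTimeComputable Instance.encode encodingIntBool.encode (jmEst hM) :=
  estInstance_polyTime (rotTable_codeFP hM)

end Encodable

end Table


end RotationTable

end Literature.Computability.QuantumComplexity.Matchgate
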